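import Mathlib
import HarnessLib

/-!
# Boltzmann's `B₄` for hard spheres in `D = 3` — proofs, part 4: the slice integrals in closed form

Topic `Literature/MathematicalPhysics/StatisticalMechanics`; pure real-analysis companion of
`BoltzmannB4HardSpheresProofs.lean` (Lyberg 2005 / Nijboer–van Hove 1952, two-centre value of the
complete star at contact). Part 3 of that file reduces `vol(lensPair e0)` to
`2∫_{1/2}^1∫_{1/2}^1 (gs + go)`, the same-side / opposite-side DISC-PAIR measures of the slices
of the two unit lenses; the disc-pair measure of squared radii `A, B, C` is (triangle case)
`π(BC·α + AC·β + AB·γ) − (π/4)(A+B+C)√H`, `α, β, γ` the angles opposite `√A, √B, √C`,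
`H = 2AB+2BC+2CA−A²−B²−C²`, and `π²AB` in the cap case. Here, with `A = 1−x²`, `B = 1−y²`
(`x, y ∈ [1/2,1]` the folded heights) and

* opposite side: `C = (x+y)(2−x−y)`, `√H = 2√2·√(1−x)√(1−y)√(x+y)`;
* same side: `C = 1−(x−y)²`, `H = 3−4x²−4y²+4xy` (triangle iff `y < y_b(x) = (x+√3√(1−x²))/2`),

we prove, for `x ∈ (1/2,1)`, the INNER integrals of the symmetrised kernels
(`2AC·β + AB·γ − (A+B+C)√H/4`; `∬BCα = ∬ACβ` by the `x ↔ y` symmetry is used in part 5)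

* `integral_kO : ∫ y in 1/2..1, kO x y = hO x`,
* `integral_kS : ∫ y in 1/2..1, kS x y = hS x` (the clamped same-side kernel equals `πAB`
  beyond `y_b`, `kS_eq_of_ge`),

by explicit `y`-antiderivatives (one integration by parts per angle; every remaining integrand is
rational in `y` and ONE square root of a quadratic — the `r = 1` "magic" making `D = 3` elementary),
and the OUTER integral of `htot = hO + hS` (the `θ₂ = arccos(√(1−x)√(1+2x)/(√(1+x)√(3−2x)))` terms
cancel between the two sides):

* `integral_htot : ∫ x in 1/2..1, htot x = −(89/1260)π + (459/1120)·arccos(1/3) − (73/1680)√2`,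

via the reduction `J_k = ∫xᵏ/√Q₂`, `Q₂ = (1−x)(1+2x)`, `J₀ = arcsin((4x−1)/3)/√2`,
`∫dx/((1+x)√Q₂) = (2θ₁ − π/2)/√2`, `θ₁ = arccos√((1−x)/(3(1+x)))` (exact rational bookkeeping of the
polynomials `polW, polPJ1, …` done offline and CHECKED here by differentiation). Consequently
`2π·∫htot = −(89/630)π² + (4131/5040)π·arccos(1/3) − (73/840)π√2 = vol(lensPair e0)` (part 5).
All algebra modulo `(√a)² = a` is closed by `field_simp; grind`.

## References

* [Lyberg2005] I. Lyberg, J. Stat. Phys. 119 (2005) 747–764, §3 (the `n = 1` case).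
* [NijboerVanhove1952] B. R. A. Nijboer, L. Van Hove, Phys. Rev. 85 (1952) 777–783 (χ(1)).
-/

noncomputable section

open Real MeasureTheory Set intervalIntegral

namespace Literature.MathematicalPhysics.StatisticalMechanics

namespace BoltzmannB4Contact

/-- Chain rule for `arccos ∘ u` with the square root pre-evaluated: if `1 - u(y)² = D²` with
`D > 0` then `(arccos ∘ u)' = -u'/D`. [folklore] -/
theorem hasDerivAt_arccos_comp {u : ℝ → ℝ} {u' y D : ℝ} (hu : HasDerivAt u u' y) (hD : 0 < D)
    (hsq : 1 - u y ^ 2 = D ^ 2) : HasDerivAt (fun y => arccos (u y)) (-u' / D) y := by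
  have hlt : u y ^ 2 < 1 := by nlinarith
  have hne1 : u y ≠ -1 := by intro h; rw [h] at hlt; norm_num at hlt
  have hne2 : u y ≠ 1 := by intro h; rw [h] at hlt; norm_num at hlt
  have h := (hasDerivAt_arccos hne1 hne2).comp y hu
  have h2 : HasDerivAt (fun y => arccos (u y)) (-(1 / √(1 - u y ^ 2)) * u') y := h
  refine h2.congr_deriv ?_
  rw [hsq, sqrt_sq hD.le]; field_simp

/-- Chain rule for `arcsin ∘ u` with the square root pre-evaluated. [folklore] -/
theorem hasDerivAt_arcsin_comp {u : ℝ → ℝ} {u' y D : ℝ} (hu : HasDerivAt u u' y) (hD : 0 < D)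
    (hsq : 1 - u y ^ 2 = D ^ 2) : HasDerivAt (fun y => arcsin (u y)) (u' / D) y := by
  have hlt : u y ^ 2 < 1 := by nlinarith
  have hne1 : u y ≠ -1 := by intro h; rw [h] at hlt; norm_num at hlt
  have hne2 : u y ≠ 1 := by intro h; rw [h] at hlt; norm_num at hlt
  have h := (hasDerivAt_arcsin hne1 hne2).comp y hu
  have h2 : HasDerivAt (fun y => arcsin (u y)) (1 / √(1 - u y ^ 2) * u') y := h
  refine h2.congr_deriv ?_
  rw [hsq, sqrt_sq hD.le]; field_simp

/-- `d/dy √(a - y) = -1/(2√(a - y))` for `y < a`. [folklore] -/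
theorem hasDerivAt_sqrt_const_sub {a y : ℝ} (h : y < a) :
    HasDerivAt (fun y => √(a - y)) (-1 / (2 * √(a - y))) y := by
  have h1 : HasDerivAt (fun y => a - y) (-1) y := by
    simpa using (hasDerivAt_id y).const_sub a
  have := h1.sqrt (by linarith : a - y ≠ 0)
  simpa using this

/-- `d/dy √(a + y) = 1/(2√(a + y))` for `-a < y`. [folklore] -/
theorem hasDerivAt_sqrt_const_add {a y : ℝ} (h : -a < y) :
    HasDerivAt (fun y => √(a + y)) (1 / (2 * √(a + y))) y := by
  have h1 : HasDerivAt (fun y => a + y) 1 y := by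
    simpa using (hasDerivAt_id y).const_add a
  have := h1.sqrt (by linarith : a + y ≠ 0)
  simpa using this

/-! ### Case O angles -/

/-- `γ_O(x,y) = arccos( √(1-x)√(1-y) / (√(1+x)√(1+y)) )`. [folklore] -/
def gamO (x y : ℝ) : ℝ := arccos (√(1 - x) * √(1 - y) / (√(1 + x) * √(1 + y)))

/-- `β_O(x,y) = arccos( √(1-x)√(x+y) / (√(1+x)√(2-x-y)) )`. [folklore] -/
def betO (x y : ℝ) : ℝ := arccos (√(1 - x) * √(x + y) / (√(1 + x) * √(2 - x - y)))

section derivs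

variable {x y : ℝ} (hx0 : 1 / 2 < x) (hx1 : x < 1) (hy0 : 1 / 2 < y) (hy1 : y < 1)
include hx0 hx1 hy0 hy1

/-- `∂γ_O/∂y = √(1-x) / ((1+y) √2 √(1-y) √(x+y))`. [folklore] -/
theorem hasDerivAt_gamO :
    HasDerivAt (fun y => gamO x y)
      (√(1 - x) / ((1 + y) * (√2 * (√(1 - y) * √(x + y))))) y := by
  have hsx : 0 < √(1 - x) := sqrt_pos.mpr (by linarith)
  have hpx : 0 < √(1 + x) := sqrt_pos.mpr (by linarith)
  have hsy : 0 < √(1 - y) := sqrt_pos.mpr (by linarith)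
  have hpy : 0 < √(1 + y) := sqrt_pos.mpr (by linarith)
  have hty : 0 < √(x + y) := sqrt_pos.mpr (by linarith)
  have h2 : (0:ℝ) < √2 := by positivity
  have esx : √(1 - x) ^ 2 = 1 - x := sq_sqrt (by linarith)
  have epx : √(1 + x) ^ 2 = 1 + x := sq_sqrt (by linarith)
  have esy : √(1 - y) ^ 2 = 1 - y := sq_sqrt (by linarith)
  have epy : √(1 + y) ^ 2 = 1 + y := sq_sqrt (by linarith)
  have ety : √(x + y) ^ 2 = x + y := sq_sqrt (by linarith)
  have e2 : √2 ^ 2 = (2:ℝ) := sq_sqrt (by norm_num)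
  -- u(y) = c * (√(1-y) / √(1+y)), c = √(1-x)/√(1+x)
  have hu : HasDerivAt (fun y => √(1 - x) * √(1 - y) / (√(1 + x) * √(1 + y)))
      (√(1 - x) / √(1 + x) * ((-1 / (2 * √(1 - y)) * √(1 + y) - √(1 - y) * (1 / (2 * √(1 + y))))
        / √(1 + y) ^ 2)) y := by
    have h := ((hasDerivAt_sqrt_const_sub hy1).div (hasDerivAt_sqrt_const_add (a := 1)
      (by linarith)) hpy.ne').const_mul (√(1 - x) / √(1 + x))
    have h' : HasDerivAt (fun y => √(1 - x) / √(1 + x) * (√(1 - y) / √(1 + y)))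
      (√(1 - x) / √(1 + x) * ((-1 / (2 * √(1 - y)) * √(1 + y) - √(1 - y) * (1 / (2 * √(1 + y))))
        / √(1 + y) ^ 2)) y := h
    convert h' using 2 with z
    field_simp
  have key := hasDerivAt_arccos_comp hu (D := √2 * √(x + y) / (√(1 + x) * √(1 + y)))
    (by positivity) (by field_simp; grind)
  refine key.congr_deriv ?_
  field_simp
  grind

/-- `∂β_O/∂y = -√(1-x) / (√2 (2-x-y) √(1-y) √(x+y))`. [folklore] -/
theorem hasDerivAt_betO :
    HasDerivAt (fun y => betO x y)
      (-√(1 - x) / (√2 * (2 - x - y) * (√(1 - y) * √(x + y)))) y := by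
  have hsx : 0 < √(1 - x) := sqrt_pos.mpr (by linarith)
  have hpx : 0 < √(1 + x) := sqrt_pos.mpr (by linarith)
  have hsy : 0 < √(1 - y) := sqrt_pos.mpr (by linarith)
  have hty : 0 < √(x + y) := sqrt_pos.mpr (by linarith)
  have hwy : 0 < √(2 - x - y) := sqrt_pos.mpr (by linarith)
  have h2 : (0:ℝ) < √2 := by positivity
  have esx : √(1 - x) ^ 2 = 1 - x := sq_sqrt (by linarith)
  have epx : √(1 + x) ^ 2 = 1 + x := sq_sqrt (by linarith)
  have esy : √(1 - y) ^ 2 = 1 - y := sq_sqrt (by linarith)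
  have ety : √(x + y) ^ 2 = x + y := sq_sqrt (by linarith)
  have ewy : √(2 - x - y) ^ 2 = 2 - x - y := sq_sqrt (by linarith)
  have e2 : √2 ^ 2 = (2:ℝ) := sq_sqrt (by norm_num)
  have hw : HasDerivAt (fun y => √(2 - x - y)) (-1 / (2 * √(2 - x - y))) y :=
    hasDerivAt_sqrt_const_sub (a := 2 - x) (by linarith)
  have hu : HasDerivAt (fun y => √(1 - x) * √(x + y) / (√(1 + x) * √(2 - x - y)))
      (√(1 - x) / √(1 + x) * ((1 / (2 * √(x + y)) * √(2 - x - y) - √(x + y) * (-1 / (2 * √(2 - x - y))))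
        / √(2 - x - y) ^ 2)) y := by
    have h := ((hasDerivAt_sqrt_const_add (a := x) (by linarith)).div hw hwy.ne').const_mul
      (√(1 - x) / √(1 + x))
    have h' : HasDerivAt (fun y => √(1 - x) / √(1 + x) * (√(x + y) / √(2 - x - y)))
      (√(1 - x) / √(1 + x) * ((1 / (2 * √(x + y)) * √(2 - x - y) - √(x + y) * (-1 / (2 * √(2 - x - y))))
        / √(2 - x - y) ^ 2)) y := h
    convert h' using 2 with z
    field_simp
  have key := hasDerivAt_arccos_comp hu (D := √2 * √(1 - y) / (√(1 + x) * √(2 - x - y)))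
    (by positivity) (by field_simp; grind)
  refine key.congr_deriv ?_
  field_simp
  grind

/-- `q(y) = √(1-y)√(x+y)` has `q' = (1 - x - 2y)/(2q)`. [folklore] -/
theorem hasDerivAt_qO :
    HasDerivAt (fun y => √(1 - y) * √(x + y))
      ((1 - x - 2 * y) / (2 * (√(1 - y) * √(x + y)))) y := by
  have hsy : 0 < √(1 - y) := sqrt_pos.mpr (by linarith)
  have hty : 0 < √(x + y) := sqrt_pos.mpr (by linarith)
  have esy : √(1 - y) ^ 2 = 1 - y := sq_sqrt (by linarith)
  have ety : √(x + y) ^ 2 = x + y := sq_sqrt (by linarith)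
  have h := (hasDerivAt_sqrt_const_sub hy1 (a := 1)).mul (hasDerivAt_sqrt_const_add (a := x)
    (by linarith))
  refine h.congr_deriv ?_
  field_simp
  grind

/-- `d/dy arcsin((2y-1+x)/(1+x)) = 1/q`. [folklore] -/
theorem hasDerivAt_asnO :
    HasDerivAt (fun y => arcsin ((2 * y - 1 + x) / (1 + x))) (1 / (√(1 - y) * √(x + y))) y := by
  have hsy : 0 < √(1 - y) := sqrt_pos.mpr (by linarith)
  have hty : 0 < √(x + y) := sqrt_pos.mpr (by linarith)
  have esy : √(1 - y) ^ 2 = 1 - y := sq_sqrt (by linarith)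
  have ety : √(x + y) ^ 2 = x + y := sq_sqrt (by linarith)
  have hx : (0:ℝ) < 1 + x := by linarith
  have hu : HasDerivAt (fun y => (2 * y - 1 + x) / (1 + x)) (2 / (1 + x)) y := by
    have h := ((((hasDerivAt_id y).const_mul 2).sub_const 1).add_const x).div_const (1 + x)
    refine (h.congr_deriv ?_)
    simp
  have key := hasDerivAt_arcsin_comp hu (D := 2 * (√(1 - y) * √(x + y)) / (1 + x))
    (by positivity) (by field_simp; grind)
  refine key.congr_deriv ?_
  field_simp

/-- `d/dy arcsin((3 - x - 4(1-x)/(1+y))/(1+x)) = √2 √(1-x)/((1+y) q)`. [folklore] -/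
theorem hasDerivAt_asnO1 :
    HasDerivAt (fun y => arcsin ((3 - x - 4 * (1 - x) / (1 + y)) / (1 + x)))
      (√2 * √(1 - x) / ((1 + y) * (√(1 - y) * √(x + y)))) y := by
  have hsy : 0 < √(1 - y) := sqrt_pos.mpr (by linarith)
  have hty : 0 < √(x + y) := sqrt_pos.mpr (by linarith)
  have hsx : 0 < √(1 - x) := sqrt_pos.mpr (by linarith)
  have h2 : (0:ℝ) < √2 := by positivity
  have esy : √(1 - y) ^ 2 = 1 - y := sq_sqrt (by linarith)
  have ety : √(x + y) ^ 2 = x + y := sq_sqrt (by linarith)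
  have esx : √(1 - x) ^ 2 = 1 - x := sq_sqrt (by linarith)
  have e2 : √2 ^ 2 = (2:ℝ) := sq_sqrt (by norm_num)
  have hx : (0:ℝ) < 1 + x := by linarith
  have hy : (0:ℝ) < 1 + y := by linarith
  have hu : HasDerivAt (fun y => (3 - x - 4 * (1 - x) / (1 + y)) / (1 + x))
      (4 * (1 - x) / (1 + y) ^ 2 / (1 + x)) y := by
    have h1 : HasDerivAt (fun y => 4 * (1 - x) / (1 + y)) (-(4 * (1 - x)) / (1 + y) ^ 2) y := by
      have h := (hasDerivAt_const y (4 * (1 - x))).div ((hasDerivAt_id' y).const_add 1) hy.ne'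
      have h'' : HasDerivAt (fun y => 4 * (1 - x) / (1 + y))
          ((0 * (1 + y) - 4 * (1 - x) * 1) / (1 + y) ^ 2) y := h
      refine h''.congr_deriv ?_; ring
    have h := (h1.const_sub (3 - x)).div_const (1 + x)
    refine h.congr_deriv ?_
    field_simp
  have key := hasDerivAt_arcsin_comp hu
    (D := 2 * √2 * √(1 - x) * (√(1 - y) * √(x + y)) / ((1 + x) * (1 + y)))
    (by positivity) (by field_simp; grind)
  refine key.congr_deriv ?_
  field_simp
  grind

/-- `d/dy arcsin((3 - x - 4(1-x)/(2-x-y))/(1+x)) = -√2 √(1-x)/((2-x-y) q)`. [folklore] -/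
theorem hasDerivAt_asnO2 :
    HasDerivAt (fun y => arcsin ((3 - x - 4 * (1 - x) / (2 - x - y)) / (1 + x)))
      (-(√2 * √(1 - x)) / ((2 - x - y) * (√(1 - y) * √(x + y)))) y := by
  have hsy : 0 < √(1 - y) := sqrt_pos.mpr (by linarith)
  have hty : 0 < √(x + y) := sqrt_pos.mpr (by linarith)
  have hsx : 0 < √(1 - x) := sqrt_pos.mpr (by linarith)
  have h2 : (0:ℝ) < √2 := by positivity
  have esy : √(1 - y) ^ 2 = 1 - y := sq_sqrt (by linarith)
  have ety : √(x + y) ^ 2 = x + y := sq_sqrt (by linarith)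
  have esx : √(1 - x) ^ 2 = 1 - x := sq_sqrt (by linarith)
  have e2 : √2 ^ 2 = (2:ℝ) := sq_sqrt (by norm_num)
  have hx : (0:ℝ) < 1 + x := by linarith
  have hw : (0:ℝ) < 2 - x - y := by linarith
  have hu : HasDerivAt (fun y => (3 - x - 4 * (1 - x) / (2 - x - y)) / (1 + x))
      (-(4 * (1 - x) / (2 - x - y) ^ 2) / (1 + x)) y := by
    have h1 : HasDerivAt (fun y => 4 * (1 - x) / (2 - x - y)) (4 * (1 - x) / (2 - x - y) ^ 2) y := by
      have h0 : HasDerivAt (fun y => 2 - x - y) (-1) y := by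
        simpa using (hasDerivAt_id y).const_sub (2 - x)
      have h := (hasDerivAt_const y (4 * (1 - x))).div h0 hw.ne'
      have h'' : HasDerivAt (fun y => 4 * (1 - x) / (2 - x - y))
          ((0 * (2 - x - y) - 4 * (1 - x) * (-1)) / (2 - x - y) ^ 2) y := h
      refine h''.congr_deriv ?_; ring
    have h := (h1.const_sub (3 - x)).div_const (1 + x)
    refine h.congr_deriv ?_
    field_simp
  have key := hasDerivAt_arcsin_comp hu
    (D := 2 * √2 * √(1 - x) * (√(1 - y) * √(x + y)) / ((1 + x) * (2 - x - y)))
    (by positivity) (by field_simp; grind)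
  refine key.congr_deriv ?_
  field_simp
  grind

end derivs

/-! ### Case O antiderivatives in `y` -/

/-- Antiderivative of `(1-y²)·γ_O` in `y`. [folklore] -/
def FO3 (x y : ℝ) : ℝ :=
  (y - y ^ 3 / 3) * gamO x y
    - √(1 - x) / (3 * √2) * ((√(1 - y) * √(x + y)) * (y / 2 - 1 / 4 - 3 * x / 4))
    - √(1 - x) * (17 / 8 - x / 4 - 3 * x ^ 2 / 8) / (3 * √2) * arcsin ((2 * y - 1 + x) / (1 + x))
    + 1 / 3 * arcsin ((3 - x - 4 * (1 - x) / (1 + y)) / (1 + x))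

/-- Antiderivative of `(x+y)(2-x-y)·β_O` in `y`. [folklore] -/
def FO2 (x y : ℝ) : ℝ :=
  ((x + y) ^ 2 - (x + y) ^ 3 / 3) * betO x y
    + √(1 - x) / (3 * √2) * ((√(1 - y) * √(x + y)) * (-y / 2 + 1 / 4 - 5 * x / 4))
    - √(1 - x) * (17 / 8 - x / 4 - 3 * x ^ 2 / 8) / (3 * √2) * arcsin ((2 * y - 1 + x) / (1 + x))
    - 2 / 3 * arcsin ((3 - x - 4 * (1 - x) / (2 - x - y)) / (1 + x))

/-- Antiderivative of `(A+B+C)·√H_O = (3 - x² - y² + … )·2√2√(1-x)√(1-y)√(x+y)` in `y`. [folklore] -/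
def FO4 (x y : ℝ) : ℝ :=
  √2 * √(1 - x) * ((19 / 16 + 3 * x / 8 - 13 * x ^ 2 / 16) * ((2 * y - 1 + x) * (√(1 - y) * √(x + y)))
    + (19 / 16 + 3 * x / 8 - 13 * x ^ 2 / 16) * (1 + x) ^ 2 / 2 * arcsin ((2 * y - 1 + x) / (1 + x))
    + (2 * y - 1 + x) / 2 * ((1 - y) * (x + y)) * (√(1 - y) * √(x + y)))

section derivs2

variable {x y : ℝ} (hx0 : 1 / 2 < x) (hx1 : x < 1) (hy0 : 1 / 2 < y) (hy1 : y < 1)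
include hx0 hx1 hy0 hy1

/-- Auxiliary step of the contact lens-pair computation (see the module docstring). [folklore] -/
theorem hasDerivAt_FO3 : HasDerivAt (fun y => FO3 x y) ((1 - y ^ 2) * gamO x y) y := by
  have hsx : 0 < √(1 - x) := sqrt_pos.mpr (by linarith)
  have hsy : 0 < √(1 - y) := sqrt_pos.mpr (by linarith)
  have hty : 0 < √(x + y) := sqrt_pos.mpr (by linarith)
  have h2 : (0:ℝ) < √2 := by positivity
  have esx : √(1 - x) ^ 2 = 1 - x := sq_sqrt (by linarith)
  have esy : √(1 - y) ^ 2 = 1 - y := sq_sqrt (by linarith)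
  have ety : √(x + y) ^ 2 = x + y := sq_sqrt (by linarith)
  have e2 : √2 ^ 2 = (2:ℝ) := sq_sqrt (by norm_num)
  have hx : (0:ℝ) < 1 + x := by linarith
  have hy : (0:ℝ) < 1 + y := by linarith
  have hP : HasDerivAt (fun y : ℝ => y - y ^ 3 / 3) (1 - y ^ 2) y := by
    have h := (hasDerivAt_id' y).sub (((hasDerivAt_id' y).pow 3).div_const 3)
    refine h.congr_deriv ?_; simp
  have hlin : HasDerivAt (fun y : ℝ => y / 2 - 1 / 4 - 3 * x / 4) (1 / 2) y :=
    (((hasDerivAt_id' y).div_const 2).sub_const (1 / 4)).sub_const (3 * x / 4)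
  have h := (((hP.mul (hasDerivAt_gamO hx0 hx1 hy0 hy1)).sub
    (((hasDerivAt_qO hx0 hx1 hy0 hy1).mul hlin).const_mul (√(1 - x) / (3 * √2)))).sub
    ((hasDerivAt_asnO hx0 hx1 hy0 hy1).const_mul
      (√(1 - x) * (17 / 8 - x / 4 - 3 * x ^ 2 / 8) / (3 * √2)))).add
    ((hasDerivAt_asnO1 hx0 hx1 hy0 hy1).const_mul (1 / 3))
  refine h.congr_deriv ?_
  field_simp
  grind

/-- Auxiliary step of the contact lens-pair computation (see the module docstring). [folklore] -/
theorem hasDerivAt_FO2 : HasDerivAt (fun y => FO2 x y) ((x + y) * (2 - x - y) * betO x y) y := by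
  have hsx : 0 < √(1 - x) := sqrt_pos.mpr (by linarith)
  have hsy : 0 < √(1 - y) := sqrt_pos.mpr (by linarith)
  have hty : 0 < √(x + y) := sqrt_pos.mpr (by linarith)
  have h2 : (0:ℝ) < √2 := by positivity
  have esx : √(1 - x) ^ 2 = 1 - x := sq_sqrt (by linarith)
  have esy : √(1 - y) ^ 2 = 1 - y := sq_sqrt (by linarith)
  have ety : √(x + y) ^ 2 = x + y := sq_sqrt (by linarith)
  have e2 : √2 ^ 2 = (2:ℝ) := sq_sqrt (by norm_num)
  have hx : (0:ℝ) < 1 + x := by linarith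
  have hw : (0:ℝ) < 2 - x - y := by linarith
  have hV : HasDerivAt (fun y : ℝ => (x + y) ^ 2 - (x + y) ^ 3 / 3) ((x + y) * (2 - x - y)) y := by
    have h1 : HasDerivAt (fun y : ℝ => x + y) 1 y := (hasDerivAt_id' y).const_add x
    have h := (h1.pow 2).sub ((h1.pow 3).div_const 3)
    refine h.congr_deriv ?_; simp; ring
  have hlin : HasDerivAt (fun y : ℝ => -y / 2 + 1 / 4 - 5 * x / 4) (-1 / 2) y := by
    have h := ((((hasDerivAt_id' y).neg).div_const 2).add_const (1 / 4)).sub_const (5 * x / 4)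
    refine h.congr_deriv ?_; simp
  have h := (((hV.mul (hasDerivAt_betO hx0 hx1 hy0 hy1)).add
    (((hasDerivAt_qO hx0 hx1 hy0 hy1).mul hlin).const_mul (√(1 - x) / (3 * √2)))).sub
    ((hasDerivAt_asnO hx0 hx1 hy0 hy1).const_mul
      (√(1 - x) * (17 / 8 - x / 4 - 3 * x ^ 2 / 8) / (3 * √2)))).sub
    ((hasDerivAt_asnO2 hx0 hx1 hy0 hy1).const_mul (2 / 3))
  refine h.congr_deriv ?_
  field_simp
  grind

/-- Auxiliary step of the contact lens-pair computation (see the module docstring). [folklore] -/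
theorem hasDerivAt_FO4 : HasDerivAt (fun y => FO4 x y)
    (((1 - x ^ 2) + (1 - y ^ 2) + (x + y) * (2 - x - y)) *
      (2 * √2 * √(1 - x) * (√(1 - y) * √(x + y)))) y := by
  have hsx : 0 < √(1 - x) := sqrt_pos.mpr (by linarith)
  have hsy : 0 < √(1 - y) := sqrt_pos.mpr (by linarith)
  have hty : 0 < √(x + y) := sqrt_pos.mpr (by linarith)
  have h2 : (0:ℝ) < √2 := by positivity
  have esx : √(1 - x) ^ 2 = 1 - x := sq_sqrt (by linarith)
  have esy : √(1 - y) ^ 2 = 1 - y := sq_sqrt (by linarith)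
  have ety : √(x + y) ^ 2 = x + y := sq_sqrt (by linarith)
  have e2 : √2 ^ 2 = (2:ℝ) := sq_sqrt (by norm_num)
  have hx : (0:ℝ) < 1 + x := by linarith
  have hl : HasDerivAt (fun y : ℝ => 2 * y - 1 + x) 2 y := by
    have h := (((hasDerivAt_id' y).const_mul 2).sub_const 1).add_const x
    refine h.congr_deriv ?_; simp
  have hQ : HasDerivAt (fun y : ℝ => (1 - y) * (x + y)) (1 - x - 2 * y) y := by
    have h := ((hasDerivAt_id' y).const_sub 1).mul ((hasDerivAt_id' y).const_add x)
    refine h.congr_deriv ?_; ring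
  have hq := hasDerivAt_qO hx0 hx1 hy0 hy1
  have h := ((((hl.mul hq).const_mul (19 / 16 + 3 * x / 8 - 13 * x ^ 2 / 16)).add
    ((hasDerivAt_asnO hx0 hx1 hy0 hy1).const_mul
      ((19 / 16 + 3 * x / 8 - 13 * x ^ 2 / 16) * (1 + x) ^ 2 / 2))).add
    (((hl.div_const 2).mul hQ).mul hq)).const_mul (√2 * √(1 - x))
  refine h.congr_deriv ?_
  simp only [Pi.mul_apply]
  field_simp
  grind

end derivs2

/-! ### Case O: the symmetrised slice kernel and its `y`-antiderivative -/

/-- Symmetrised case-O kernel `2AC·β + AB·γ − (A+B+C)√H/4` (`A = 1-x²`, `B = 1-y²`,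
`C = (x+y)(2-x-y)`, `√H = 2√2√(1-x)√(1-y)√(x+y)`). [folklore] -/
def kO (x y : ℝ) : ℝ :=
  2 * (1 - x ^ 2) * ((x + y) * (2 - x - y)) * betO x y + (1 - x ^ 2) * (1 - y ^ 2) * gamO x y
    - ((1 - x ^ 2) + (1 - y ^ 2) + (x + y) * (2 - x - y)) *
      (2 * √2 * √(1 - x) * (√(1 - y) * √(x + y))) / 4

/-- `y`-antiderivative of `kO x`. [folklore] -/
def FO (x y : ℝ) : ℝ := 2 * (1 - x ^ 2) * FO2 x y + (1 - x ^ 2) * FO3 x y - FO4 x y / 4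

/-- Auxiliary step of the contact lens-pair computation (see the module docstring). [folklore] -/
theorem hasDerivAt_FO {x y : ℝ} (hx0 : 1 / 2 < x) (hx1 : x < 1) (hy0 : 1 / 2 < y) (hy1 : y < 1) :
    HasDerivAt (fun y => FO x y) (kO x y) y := by
  have h := (((hasDerivAt_FO2 hx0 hx1 hy0 hy1).const_mul (2 * (1 - x ^ 2))).add
    ((hasDerivAt_FO3 hx0 hx1 hy0 hy1).const_mul (1 - x ^ 2))).sub
    ((hasDerivAt_FO4 hx0 hx1 hy0 hy1).div_const 4)
  refine h.congr_deriv ?_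
  simp only [kO]; ring

/-! ### continuity on `[1/2, 1]` -/

section cont
variable {x : ℝ} (hx0 : 1 / 2 < x) (hx1 : x < 1)
include hx0 hx1

/-- Auxiliary step of the contact lens-pair computation (see the module docstring). [folklore] -/
theorem continuousOn_gamO : ContinuousOn (fun y => gamO x y) (Icc (1 / 2) 1) := by
  unfold gamO
  refine continuous_arccos.comp_continuousOn (ContinuousOn.div (by fun_prop) (by fun_prop) ?_)
  intro y hy
  have : 0 < √(1 + x) := sqrt_pos.mpr (by linarith)
  have : 0 < √(1 + y) := sqrt_pos.mpr (by linarith [hy.1])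
  positivity

/-- Auxiliary step of the contact lens-pair computation (see the module docstring). [folklore] -/
theorem continuousOn_betO : ContinuousOn (fun y => betO x y) (Icc (1 / 2) 1) := by
  unfold betO
  refine continuous_arccos.comp_continuousOn (ContinuousOn.div (by fun_prop) (by fun_prop) ?_)
  intro y hy
  have : 0 < √(1 + x) := sqrt_pos.mpr (by linarith)
  have : 0 < √(2 - x - y) := sqrt_pos.mpr (by linarith [hy.2])
  positivity

omit hx0 hx1 in
/-- Auxiliary step of the contact lens-pair computation (see the module docstring). [folklore] -/
theorem continuousOn_asnO1 :
    ContinuousOn (fun y => arcsin ((3 - x - 4 * (1 - x) / (1 + y)) / (1 + x))) (Icc (1 / 2) 1) := by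
  refine continuous_arcsin.comp_continuousOn (ContinuousOn.div_const ?_ _)
  refine continuousOn_const.sub (ContinuousOn.div continuousOn_const (by fun_prop) ?_)
  intro y hy; have := hy.1; positivity

omit hx0 in
/-- Auxiliary step of the contact lens-pair computation (see the module docstring). [folklore] -/
theorem continuousOn_asnO2 :
    ContinuousOn (fun y => arcsin ((3 - x - 4 * (1 - x) / (2 - x - y)) / (1 + x))) (Icc (1 / 2) 1) := by
  refine continuous_arcsin.comp_continuousOn (ContinuousOn.div_const ?_ _)
  refine continuousOn_const.sub (ContinuousOn.div continuousOn_const (by fun_prop) ?_)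
  intro y hy; have := hy.2; intro h; linarith

/-- Auxiliary step of the contact lens-pair computation (see the module docstring). [folklore] -/
theorem continuousOn_FO : ContinuousOn (fun y => FO x y) (Icc (1 / 2) 1) := by
  have h1 := continuousOn_gamO hx0 hx1
  have h2 := continuousOn_betO hx0 hx1
  have h3 := continuousOn_asnO1 (x := x)
  have h4 := continuousOn_asnO2 (x := x) hx1
  unfold FO FO2 FO3 FO4
  apply ContinuousOn.sub
  · apply ContinuousOn.add
    · apply ContinuousOn.mul continuousOn_const
      apply ContinuousOn.sub
      · apply ContinuousOn.sub
        · exact ContinuousOn.add (ContinuousOn.mul (by fun_prop) h2) (by fun_prop)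
        · fun_prop
      · exact ContinuousOn.mul continuousOn_const h4
    · apply ContinuousOn.mul continuousOn_const
      apply ContinuousOn.add
      · apply ContinuousOn.sub
        · exact ContinuousOn.sub (ContinuousOn.mul (by fun_prop) h1) (by fun_prop)
        · fun_prop
      · exact ContinuousOn.mul continuousOn_const h3
  · fun_prop

/-- Auxiliary step of the contact lens-pair computation (see the module docstring). [folklore] -/
theorem continuousOn_kO : ContinuousOn (fun y => kO x y) (Icc (1 / 2) 1) := by
  have h1 := continuousOn_gamO hx0 hx1
  have h2 := continuousOn_betO hx0 hx1
  unfold kO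
  apply ContinuousOn.sub
  · apply ContinuousOn.add
    · exact ContinuousOn.mul (by fun_prop) h2
    · exact ContinuousOn.mul (by fun_prop) h1
  · fun_prop

end cont

/-- **Case O inner integral by the fundamental theorem of calculus.** [folklore] -/
theorem integral_kO_eq {x : ℝ} (hx0 : 1 / 2 < x) (hx1 : x < 1) :
    ∫ y in (1 / 2 : ℝ)..1, kO x y = FO x 1 - FO x (1 / 2) := by
  apply integral_eq_sub_of_hasDerivAt_of_le (by norm_num) (continuousOn_FO hx0 hx1)
  · intro y hy
    exact hasDerivAt_FO hx0 hx1 hy.1 hy.2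
  · exact (continuousOn_kO hx0 hx1).intervalIntegrable_of_Icc (by norm_num)

/-! ### Case O: evaluation of the antiderivative at `y = 1` and `y = 1/2` -/

/-- `Q₂(x) = (1 - x)(1 + 2x)`. [folklore] -/
def Q₂ (x : ℝ) : ℝ := (1 - x) * (1 + 2 * x)

/-- `θ₁(x) = arccos √((1 - x)/(3(1 + x)))`. [folklore] -/
def th1 (x : ℝ) : ℝ := arccos (√((1 - x) / (3 * (1 + x))))

/-- `θ₂(x) = arccos( √(1-x)√(1+2x) / (√(1+x)√(3-2x)) )`. [folklore] -/
def th2 (x : ℝ) : ℝ := arccos (√(1 - x) * √(1 + 2 * x) / (√(1 + x) * √(3 - 2 * x)))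

/-- `φ(x) = arcsin(x/(1 + x))`. [folklore] -/
def phi (x : ℝ) : ℝ := arcsin (x / (1 + x))

/-- `arcsin m = 2·arccos √((1 - m)/2) - π/2` (double angle). [folklore] -/
theorem arcsin_eq_two_arccos_sqrt {m : ℝ} (hm1 : -1 ≤ m) (hm2 : m ≤ 1) :
    arcsin m = 2 * arccos (√((1 - m) / 2)) - π / 2 := by
  set t := arccos (√((1 - m) / 2)) with ht
  have hs1 : √((1 - m) / 2) ≤ 1 := by
    calc √((1 - m) / 2) ≤ √1 := sqrt_le_sqrt (by linarith)
      _ = 1 := sqrt_one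
  have hc : cos t = √((1 - m) / 2) := by
    rw [ht, cos_arccos (by linarith [sqrt_nonneg ((1 - m) / 2)]) hs1]
  have hcos2 : cos (2 * t) = -m := by
    rw [cos_two_mul, hc, sq_sqrt (by linarith)]; ring
  have ht0 : 0 ≤ t := arccos_nonneg _
  have ht1 : t ≤ π / 2 := by
    rw [ht]; exact arccos_le_pi_div_two.mpr (sqrt_nonneg _)
  have hsin : sin (2 * t - π / 2) = m := by
    rw [sin_sub_pi_div_two, hcos2]; ring
  rw [← hsin, arcsin_sin (by linarith) (by linarith)]

section values
variable {x : ℝ} (hx0 : 1 / 2 < x) (hx1 : x < 1)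
include hx0 hx1

omit hx0 hx1 in
/-- Auxiliary step of the contact lens-pair computation (see the module docstring). [folklore] -/
theorem gamO_one : gamO x 1 = π / 2 := by simp [gamO]

/-- Auxiliary step of the contact lens-pair computation (see the module docstring). [folklore] -/
theorem betO_one : betO x 1 = 0 := by
  unfold betO
  have h1 : 0 < √(1 - x) := sqrt_pos.mpr (by linarith)
  have h2 : 0 < √(1 + x) := sqrt_pos.mpr (by linarith)
  rw [show (2:ℝ) - x - 1 = 1 - x by ring, show x + 1 = 1 + x by ring,
    show √(1 - x) * √(1 + x) / (√(1 + x) * √(1 - x)) = 1 by field_simp, arccos_one]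

/-- Auxiliary step of the contact lens-pair computation (see the module docstring). [folklore] -/
theorem gamO_half : gamO x (1 / 2) = th1 x := by
  unfold gamO th1
  congr 1
  have h2 : 0 < √(1 + x) := sqrt_pos.mpr (by linarith)
  have h3 : (0:ℝ) < √3 := by positivity
  have h4 : (0:ℝ) < √2 := by positivity
  have a1 : √((1:ℝ) - 1 / 2) = 1 / √2 := by
    rw [show (1:ℝ) - 1 / 2 = 1 / 2 by norm_num, sqrt_div zero_le_one, sqrt_one]
  have a2 : √((1:ℝ) + 1 / 2) = √3 / √2 := by
    rw [show (1:ℝ) + 1 / 2 = 3 / 2 by norm_num, sqrt_div (by norm_num)]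
  have a3 : √((1 - x) / (3 * (1 + x))) = √(1 - x) / (√3 * √(1 + x)) := by
    rw [sqrt_div (by linarith), sqrt_mul (by norm_num)]
  rw [a1, a2, a3]
  field_simp

/-- Auxiliary step of the contact lens-pair computation (see the module docstring). [folklore] -/
theorem betO_half : betO x (1 / 2) = th2 x := by
  unfold betO th2
  congr 1
  have h1 : 0 < √(1 - x) := sqrt_pos.mpr (by linarith)
  have h2 : 0 < √(1 + x) := sqrt_pos.mpr (by linarith)
  have h3 : 0 < √(3 - 2 * x) := sqrt_pos.mpr (by linarith)
  have h4 : 0 < √(3 / 2 - x) := sqrt_pos.mpr (by linarith)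
  have e1 : √(x + 1 / 2) = √(1 + 2 * x) / √2 := by
    rw [← sqrt_div (by linarith)]; congr 1; ring
  have e2 : √(2 - x - 1 / 2) = √(3 - 2 * x) / √2 := by
    rw [← sqrt_div (by linarith)]; congr 1; ring
  rw [e1, e2]
  have : (0:ℝ) < √2 := by positivity
  field_simp

omit hx1 in
/-- Auxiliary step of the contact lens-pair computation (see the module docstring). [folklore] -/
theorem asnO_one : arcsin ((2 * 1 - 1 + x) / (1 + x)) = π / 2 := by
  have hx : (1:ℝ) + x ≠ 0 := by intro h; linarith
  rw [show (2 * 1 - 1 + x) / (1 + x) = (1:ℝ) by field_simp; ring, arcsin_one]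

omit hx0 hx1 in
/-- Auxiliary step of the contact lens-pair computation (see the module docstring). [folklore] -/
theorem asnO_half : arcsin ((2 * (1 / 2) - 1 + x) / (1 + x)) = phi x := by
  unfold phi; congr 1; ring

omit hx1 in
/-- Auxiliary step of the contact lens-pair computation (see the module docstring). [folklore] -/
theorem asnO1_one : arcsin ((3 - x - 4 * (1 - x) / (1 + 1)) / (1 + x)) = π / 2 := by
  have hx : (1:ℝ) + x ≠ 0 := by intro h; linarith
  rw [show (3 - x - 4 * (1 - x) / (1 + 1)) / (1 + x) = (1:ℝ) by field_simp; ring, arcsin_one]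

/-- Auxiliary step of the contact lens-pair computation (see the module docstring). [folklore] -/
theorem asnO2_one : arcsin ((3 - x - 4 * (1 - x) / (2 - x - 1)) / (1 + x)) = -(π / 2) := by
  have h : (1:ℝ) - x ≠ 0 := by intro h; linarith
  rw [show (3 - x - 4 * (1 - x) / (2 - x - 1)) / (1 + x) = (-1:ℝ) by
    rw [show (2:ℝ) - x - 1 = 1 - x by ring]; field_simp; ring, arcsin_neg, arcsin_one]

/-- Auxiliary step of the contact lens-pair computation (see the module docstring). [folklore] -/
theorem asnO1_half : arcsin ((3 - x - 4 * (1 - x) / (1 + 1 / 2)) / (1 + x)) = 2 * th1 x - π / 2 := by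
  have hx : (0:ℝ) < 1 + x := by linarith
  have hm : (3 - x - 4 * (1 - x) / (1 + 1 / 2)) / (1 + x) = (1 + 5 * x) / (3 * (1 + x)) := by
    field_simp; ring
  rw [hm, arcsin_eq_two_arccos_sqrt, th1]
  · congr 3; congr 1
    field_simp; ring
  · rw [le_div_iff₀ (by positivity)]; linarith
  · rw [div_le_one (by positivity)]; linarith

/-- Auxiliary step of the contact lens-pair computation (see the module docstring). [folklore] -/
theorem asnO2_half :
    arcsin ((3 - x - 4 * (1 - x) / (2 - x - 1 / 2)) / (1 + x)) = 2 * th2 x - π / 2 := by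
  have hx : (0:ℝ) < 1 + x := by linarith
  have h3 : (0:ℝ) < 3 - 2 * x := by linarith
  have hm : (3 - x - 4 * (1 - x) / (2 - x - 1 / 2)) / (1 + x) =
      (2 * x ^ 2 - x + 1) / ((1 + x) * (3 - 2 * x)) := by
    have h3' : (3:ℝ) - 2 * x ≠ 0 := h3.ne'
    have e1 : (3 - x - 4 * (1 - x) / (2 - x - 1 / 2)) = (2 * x ^ 2 - x + 1) / (3 - 2 * x) := by
      rw [eq_div_iff h3', sub_mul, show (2:ℝ) - x - 1 / 2 = (3 - 2 * x) / 2 by ring,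
        div_div_eq_mul_div, div_mul_cancel₀ _ h3']
      ring
    rw [e1, div_div, mul_comm (3 - 2 * x)]
  rw [hm, arcsin_eq_two_arccos_sqrt, th2]
  · congr 3
    have h1 : 0 < √(1 + x) := sqrt_pos.mpr hx
    have h2 : 0 < √(3 - 2 * x) := sqrt_pos.mpr h3
    rw [show (1 - (2 * x ^ 2 - x + 1) / ((1 + x) * (3 - 2 * x))) / 2 =
        ((1 - x) * (1 + 2 * x)) / ((1 + x) * (3 - 2 * x)) by field_simp; ring,
      sqrt_div (by nlinarith), sqrt_mul (by linarith), sqrt_mul (by linarith)]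
  · rw [le_div_iff₀ (by positivity)]; nlinarith
  · rw [div_le_one (by positivity)]; nlinarith

omit hx1 in
/-- Auxiliary step of the contact lens-pair computation (see the module docstring). [folklore] -/
theorem sqrt_half_mul : √(1 - 1 / 2) * √(x + 1 / 2) = √(1 + 2 * x) / 2 := by
  rw [← sqrt_mul (by norm_num), show (1 - 1 / 2) * (x + 1 / 2) = (1 + 2 * x) / 4 by ring,
    sqrt_div (by linarith), show (4:ℝ) = 2 ^ 2 by norm_num, sqrt_sq (by norm_num)]

omit hx0 in
/-- Auxiliary step of the contact lens-pair computation (see the module docstring). [folklore] -/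
theorem sqrt_Q₂_eq : √(Q₂ x) = √(1 - x) * √(1 + 2 * x) := by
  unfold Q₂; exact sqrt_mul (by linarith) _

end values

/-- The case-O outer integrand `h_O(x) = ∫_{1/2}^1 kO x y dy`. [folklore] -/
def hO (x : ℝ) : ℝ :=
  2 * π / 3 * (1 - x ^ 2) - 9 / 8 * (1 - x ^ 2) * th1 x
    + (1 - x ^ 2) * (8 * x ^ 3 - 12 * x ^ 2 - 18 * x + 27) / 12 * th2 x
    - √2 / 128 * (1 + x) * (11 * x ^ 3 - 15 * x ^ 2 - 127 * x + 155) * √(1 - x) * (π / 2 - phi x)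
    + √2 / 384 * x * (119 + 30 * x - 95 * x ^ 2) * √(Q₂ x)

/-- Auxiliary step of the contact lens-pair computation (see the module docstring). [folklore] -/
theorem FO_eval {x : ℝ} (hx0 : 1 / 2 < x) (hx1 : x < 1) : FO x 1 - FO x (1 / 2) = hO x := by
  have hsx : 0 < √(1 - x) := sqrt_pos.mpr (by linarith)
  have h2 : (0:ℝ) < √2 := by positivity
  have e2 : √2 ^ 2 = (2:ℝ) := sq_sqrt (by norm_num)
  have hx : (0:ℝ) < 1 + x := by linarith
  unfold FO FO2 FO3 FO4 hO
  rw [gamO_one, betO_one hx0 hx1, gamO_half hx0 hx1, betO_half hx0 hx1, asnO_one hx0,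
    asnO_half, asnO1_one hx0, asnO2_one hx0 hx1, asnO1_half hx0 hx1, asnO2_half hx0 hx1,
    sqrt_half_mul hx0, sqrt_Q₂_eq hx1, show √(1 - (1:ℝ)) = 0 by simp]
  field_simp
  grind

/-! ### Case S: the same-side slice kernel -/

/-- `H_S = 3 - 4x² - 4y² + 4xy` (Heron quantity of the same-side slice triangle). [folklore] -/
def HS (x y : ℝ) : ℝ := 3 - 4 * x ^ 2 - 4 * y ^ 2 + 4 * x * y

/-- `γ_S(x,y) = arccos( (1 - 2xy) / (2√(1-x²)√(1-y²)) )`. [folklore] -/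
def gamS (x y : ℝ) : ℝ := arccos ((1 - 2 * x * y) / (2 * (√(1 - x ^ 2) * √(1 - y ^ 2))))

/-- `β_S(x,y) = arccos( (1 + 2xy - 2x²) / (2√(1-x²)√(1-(x-y)²)) )`. [folklore] -/
def betS (x y : ℝ) : ℝ := arccos ((1 + 2 * x * y - 2 * x ^ 2) / (2 * (√(1 - x ^ 2) * √(1 - (x - y) ^ 2))))

/-- the upper limit `y_b(x) = (x + √3 √(1-x²))/2` of the non-degenerate (triangle) regime [folklore] -/
def yb (x : ℝ) : ℝ := (x + √3 * √(1 - x ^ 2)) / 2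

/-- Auxiliary step of the contact lens-pair computation (see the module docstring). [folklore] -/
theorem HS_eq (x y : ℝ) : HS x y = 3 * (1 - x ^ 2) - (2 * y - x) ^ 2 := by unfold HS; ring

section derivs

variable {x y : ℝ} (hx0 : 1 / 2 < x) (hx1 : x < 1) (hy0 : 1 / 2 < y) (hyb : y < yb x)
include hx0 hx1 hy0 hyb

omit hy0 hyb in
/-- Auxiliary step of the contact lens-pair computation (see the module docstring). [folklore] -/
theorem yb_lt_one : yb x < 1 := by
  unfold yb
  have hA : 0 < 1 - x ^ 2 := by nlinarith
  have h3 : √3 * √(1 - x ^ 2) = √(3 * (1 - x ^ 2)) := (sqrt_mul (by norm_num) _).symm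
  have hlt : √(3 * (1 - x ^ 2)) < 2 - x := by
    rw [sqrt_lt' (by linarith)]
    nlinarith
  linarith

omit hy0 in
/-- Auxiliary step of the contact lens-pair computation (see the module docstring). [folklore] -/
theorem y_lt_one : y < 1 := hyb.trans (yb_lt_one hx0 hx1)

/-- Auxiliary step of the contact lens-pair computation (see the module docstring). [folklore] -/
theorem HS_pos : 0 < HS x y := by
  rw [HS_eq]
  have hA : 0 < 1 - x ^ 2 := by nlinarith
  have h1 : 2 * y - x < √3 * √(1 - x ^ 2) := by unfold yb at hyb; linarith
  have h2 : 0 < 2 * y - x := by linarith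
  have h3 : (2 * y - x) ^ 2 < (√3 * √(1 - x ^ 2)) ^ 2 := by
    exact pow_lt_pow_left₀ h1 h2.le (by norm_num)
  rw [mul_pow, sq_sqrt (by norm_num), sq_sqrt hA.le] at h3
  linarith

/-- `∂γ_S/∂y = (2x - y)/((1 - y²)√H)`. [folklore] -/
theorem hasDerivAt_gamS :
    HasDerivAt (fun y => gamS x y) ((2 * x - y) / ((1 - y ^ 2) * √(HS x y))) y := by
  have hy1 := y_lt_one hx0 hx1 hyb
  have hH := HS_pos hx0 hx1 hy0 hyb
  have hA : 0 < 1 - x ^ 2 := by nlinarith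
  have hB : 0 < 1 - y ^ 2 := by nlinarith
  have hsA : 0 < √(1 - x ^ 2) := sqrt_pos.mpr hA
  have hsB : 0 < √(1 - y ^ 2) := sqrt_pos.mpr hB
  have hr : 0 < √(HS x y) := sqrt_pos.mpr hH
  have esA : √(1 - x ^ 2) ^ 2 = 1 - x ^ 2 := sq_sqrt hA.le
  have esB : √(1 - y ^ 2) ^ 2 = 1 - y ^ 2 := sq_sqrt hB.le
  have er : √(HS x y) ^ 2 = HS x y := sq_sqrt hH.le
  have hBd : HasDerivAt (fun y : ℝ => √(1 - y ^ 2)) (-(2 * y) / (2 * √(1 - y ^ 2))) y := by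
    have h : HasDerivAt (fun y : ℝ => 1 - y ^ 2) (-(2 * y)) y := by
      simpa using ((hasDerivAt_id' y).pow 2).const_sub 1
    exact h.sqrt hB.ne'
  have hu : HasDerivAt (fun y => (1 - 2 * x * y) / (2 * (√(1 - x ^ 2) * √(1 - y ^ 2))))
      ((-(2 * x) * (2 * (√(1 - x ^ 2) * √(1 - y ^ 2))) -
        (1 - 2 * x * y) * (2 * (√(1 - x ^ 2) * (-(2 * y) / (2 * √(1 - y ^ 2)))))) /
        (2 * (√(1 - x ^ 2) * √(1 - y ^ 2))) ^ 2) y := by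
    have hn : HasDerivAt (fun y : ℝ => 1 - 2 * x * y) (-(2 * x)) y := by
      simpa using ((hasDerivAt_id' y).const_mul (2 * x)).const_sub 1
    exact hn.div ((hBd.const_mul _).const_mul 2) (by positivity)
  have key := hasDerivAt_arccos_comp hu (D := √(HS x y) / (2 * (√(1 - x ^ 2) * √(1 - y ^ 2))))
    (by positivity) (by unfold HS at er ⊢; field_simp; grind)
  refine key.congr_deriv ?_
  unfold HS at er ⊢
  field_simp
  grind

/-- `∂β_S/∂y = -(x + y)/((1 - (x-y)²)√H)`. [folklore] -/
theorem hasDerivAt_betS :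
    HasDerivAt (fun y => betS x y) (-(x + y) / ((1 - (x - y) ^ 2) * √(HS x y))) y := by
  have hy1 := y_lt_one hx0 hx1 hyb
  have hH := HS_pos hx0 hx1 hy0 hyb
  have hA : 0 < 1 - x ^ 2 := by nlinarith
  have hC : 0 < 1 - (x - y) ^ 2 := by nlinarith
  have hsA : 0 < √(1 - x ^ 2) := sqrt_pos.mpr hA
  have hsC : 0 < √(1 - (x - y) ^ 2) := sqrt_pos.mpr hC
  have hr : 0 < √(HS x y) := sqrt_pos.mpr hH
  have esA : √(1 - x ^ 2) ^ 2 = 1 - x ^ 2 := sq_sqrt hA.le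
  have esC : √(1 - (x - y) ^ 2) ^ 2 = 1 - (x - y) ^ 2 := sq_sqrt hC.le
  have er : √(HS x y) ^ 2 = HS x y := sq_sqrt hH.le
  have hCd : HasDerivAt (fun y : ℝ => √(1 - (x - y) ^ 2))
      (-(2 * (x - y) ^ (2 - 1) * (-1)) / (2 * √(1 - (x - y) ^ 2))) y := by
    have h : HasDerivAt (fun y : ℝ => 1 - (x - y) ^ 2) (-(2 * (x - y) ^ (2 - 1) * (-1))) y := by
      exact (((hasDerivAt_id' y).const_sub x).pow 2).const_sub 1
    exact h.sqrt hC.ne'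
  have hu : HasDerivAt (fun y => (1 + 2 * x * y - 2 * x ^ 2) / (2 * (√(1 - x ^ 2) * √(1 - (x - y) ^ 2))))
      (((2 * x) * (2 * (√(1 - x ^ 2) * √(1 - (x - y) ^ 2))) -
        (1 + 2 * x * y - 2 * x ^ 2) * (2 * (√(1 - x ^ 2) *
          (-(2 * (x - y) ^ (2 - 1) * (-1)) / (2 * √(1 - (x - y) ^ 2)))))) /
        (2 * (√(1 - x ^ 2) * √(1 - (x - y) ^ 2))) ^ 2) y := by
    have hn : HasDerivAt (fun y : ℝ => 1 + 2 * x * y - 2 * x ^ 2) (2 * x) y := by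
      simpa using (((hasDerivAt_id' y).const_mul (2 * x)).const_add 1).sub_const (2 * x ^ 2)
    exact hn.div ((hCd.const_mul _).const_mul 2) (by positivity)
  have key := hasDerivAt_arccos_comp hu (D := √(HS x y) / (2 * (√(1 - x ^ 2) * √(1 - (x - y) ^ 2))))
    (by positivity) (by unfold HS at er ⊢; field_simp; grind)
  refine key.congr_deriv ?_
  unfold HS at er ⊢
  simp only [show (2:ℕ) - 1 = 1 from rfl, pow_one]
  field_simp
  grind

/-- `∂√H/∂y = (2x - 4y)/√H`. [folklore] -/
theorem hasDerivAt_rS : HasDerivAt (fun y => √(HS x y)) ((2 * x - 4 * y) / √(HS x y)) y := by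
  have hH := HS_pos hx0 hx1 hy0 hyb
  have hr : 0 < √(HS x y) := sqrt_pos.mpr hH
  have h : HasDerivAt (fun y => HS x y) (-(4 * (2 * y ^ (2 - 1) * 1)) + 4 * x * 1) y := by
    unfold HS
    exact ((((hasDerivAt_id' y).pow 2).const_mul 4).const_sub (3 - 4 * x ^ 2)).add
      ((hasDerivAt_id' y).const_mul (4 * x))
  have h2 := h.sqrt hH.ne'
  refine h2.congr_deriv ?_
  simp only [show (2:ℕ) - 1 = 1 from rfl, pow_one]
  field_simp
  ring

/-- `d/dy arcsin((2y - x)/(√3 √(1-x²))) = 2/√H`. [folklore] -/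
theorem hasDerivAt_asnS :
    HasDerivAt (fun y => arcsin ((2 * y - x) / (√3 * √(1 - x ^ 2)))) (2 / √(HS x y)) y := by
  have hH := HS_pos hx0 hx1 hy0 hyb
  have hA : 0 < 1 - x ^ 2 := by nlinarith
  have hsA : 0 < √(1 - x ^ 2) := sqrt_pos.mpr hA
  have hr : 0 < √(HS x y) := sqrt_pos.mpr hH
  have h3 : (0:ℝ) < √3 := by positivity
  have esA : √(1 - x ^ 2) ^ 2 = 1 - x ^ 2 := sq_sqrt hA.le
  have er : √(HS x y) ^ 2 = HS x y := sq_sqrt hH.le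
  have e3 : √3 ^ 2 = (3:ℝ) := sq_sqrt (by norm_num)
  have hu : HasDerivAt (fun y => (2 * y - x) / (√3 * √(1 - x ^ 2))) (2 / (√3 * √(1 - x ^ 2))) y := by
    have h := (((hasDerivAt_id' y).const_mul 2).sub_const x).div_const (√3 * √(1 - x ^ 2))
    refine h.congr_deriv ?_; simp
  have key := hasDerivAt_arcsin_comp hu (D := √(HS x y) / (√3 * √(1 - x ^ 2)))
    (by positivity) (by unfold HS at er ⊢; field_simp; grind)
  refine key.congr_deriv ?_
  field_simp

/-- `d/dy arcsin((2(2+x) - (1+2x)²/(1+y))/(2√3√(1-x²))) = (1+2x)/((1+y)√H)`. [folklore] -/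
theorem hasDerivAt_piS1 :
    HasDerivAt (fun y => arcsin ((2 * (2 + x) - (1 + 2 * x) ^ 2 / (1 + y)) / (2 * √3 * √(1 - x ^ 2))))
      ((1 + 2 * x) / ((1 + y) * √(HS x y))) y := by
  have hH := HS_pos hx0 hx1 hy0 hyb
  have hA : 0 < 1 - x ^ 2 := by nlinarith
  have hsA : 0 < √(1 - x ^ 2) := sqrt_pos.mpr hA
  have hr : 0 < √(HS x y) := sqrt_pos.mpr hH
  have h3 : (0:ℝ) < √3 := by positivity
  have esA : √(1 - x ^ 2) ^ 2 = 1 - x ^ 2 := sq_sqrt hA.le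
  have er : √(HS x y) ^ 2 = HS x y := sq_sqrt hH.le
  have e3 : √3 ^ 2 = (3:ℝ) := sq_sqrt (by norm_num)
  have hy : (0:ℝ) < 1 + y := by linarith
  have hx : (0:ℝ) < 1 + 2 * x := by linarith
  have hu : HasDerivAt (fun y => (2 * (2 + x) - (1 + 2 * x) ^ 2 / (1 + y)) / (2 * √3 * √(1 - x ^ 2)))
      (((1 + 2 * x) ^ 2 / (1 + y) ^ 2) / (2 * √3 * √(1 - x ^ 2))) y := by
    have h1 : HasDerivAt (fun y => (1 + 2 * x) ^ 2 / (1 + y)) (-((1 + 2 * x) ^ 2) / (1 + y) ^ 2) y := by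
      have h := (hasDerivAt_const y ((1 + 2 * x) ^ 2)).div ((hasDerivAt_id' y).const_add 1) hy.ne'
      have h' : HasDerivAt (fun y => (1 + 2 * x) ^ 2 / (1 + y))
          ((0 * (1 + y) - (1 + 2 * x) ^ 2 * 1) / (1 + y) ^ 2) y := h
      refine h'.congr_deriv ?_; ring
    have h := (h1.const_sub (2 * (2 + x))).div_const (2 * √3 * √(1 - x ^ 2))
    refine h.congr_deriv ?_
    field_simp
  have key := hasDerivAt_arcsin_comp hu
    (D := (1 + 2 * x) * √(HS x y) / (2 * √3 * √(1 - x ^ 2) * (1 + y)))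
    (by positivity) (by unfold HS at er ⊢; field_simp; grind)
  refine key.congr_deriv ?_
  field_simp

/-- `d/dy arcsin((2(2-x) - (2x-1)²/(1+y-x))/(2√3√(1-x²))) = (2x-1)/((1+y-x)√H)`. [folklore] -/
theorem hasDerivAt_piS2 :
    HasDerivAt (fun y => arcsin ((2 * (2 - x) - (2 * x - 1) ^ 2 / (1 + y - x)) / (2 * √3 * √(1 - x ^ 2))))
      ((2 * x - 1) / ((1 + y - x) * √(HS x y))) y := by
  have hH := HS_pos hx0 hx1 hy0 hyb
  have hA : 0 < 1 - x ^ 2 := by nlinarith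
  have hsA : 0 < √(1 - x ^ 2) := sqrt_pos.mpr hA
  have hr : 0 < √(HS x y) := sqrt_pos.mpr hH
  have h3 : (0:ℝ) < √3 := by positivity
  have esA : √(1 - x ^ 2) ^ 2 = 1 - x ^ 2 := sq_sqrt hA.le
  have er : √(HS x y) ^ 2 = HS x y := sq_sqrt hH.le
  have e3 : √3 ^ 2 = (3:ℝ) := sq_sqrt (by norm_num)
  have hw : (0:ℝ) < 1 + y - x := by linarith
  have hx : (0:ℝ) < 2 * x - 1 := by linarith
  have hu : HasDerivAt
      (fun y => (2 * (2 - x) - (2 * x - 1) ^ 2 / (1 + y - x)) / (2 * √3 * √(1 - x ^ 2)))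
      (((2 * x - 1) ^ 2 / (1 + y - x) ^ 2) / (2 * √3 * √(1 - x ^ 2))) y := by
    have h1 : HasDerivAt (fun y => (2 * x - 1) ^ 2 / (1 + y - x))
        (-((2 * x - 1) ^ 2) / (1 + y - x) ^ 2) y := by
      have h0 : HasDerivAt (fun y : ℝ => 1 + y - x) 1 y := by
        simpa using ((hasDerivAt_id' y).const_add 1).sub_const x
      have h := (hasDerivAt_const y ((2 * x - 1) ^ 2)).div h0 hw.ne'
      have h' : HasDerivAt (fun y => (2 * x - 1) ^ 2 / (1 + y - x))
          ((0 * (1 + y - x) - (2 * x - 1) ^ 2 * 1) / (1 + y - x) ^ 2) y := h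
      refine h'.congr_deriv ?_; ring
    have h := (h1.const_sub (2 * (2 - x))).div_const (2 * √3 * √(1 - x ^ 2))
    refine h.congr_deriv ?_
    field_simp
  have key := hasDerivAt_arcsin_comp hu
    (D := (2 * x - 1) * √(HS x y) / (2 * √3 * √(1 - x ^ 2) * (1 + y - x)))
    (by positivity) (by unfold HS at er ⊢; field_simp; grind)
  refine key.congr_deriv ?_
  field_simp

end derivs

/-! ### Case S antiderivatives on `(1/2, y_b)` -/

/-- Antiderivative of `(1-y²)·γ_S` in `y`. [folklore] -/
def FS3 (x y : ℝ) : ℝ :=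
  (y - y ^ 3 / 3 - 2 / 3) * gamS x y + √(HS x y) * (5 * x - 2 * y) / 48
    - (13 + 9 * x ^ 2) / 48 * arcsin ((2 * y - x) / (√3 * √(1 - x ^ 2)))
    + 2 / 3 * arcsin ((2 * (2 + x) - (1 + 2 * x) ^ 2 / (1 + y)) / (2 * √3 * √(1 - x ^ 2)))

/-- Antiderivative of `(1-(x-y)²)·β_S` in `y`. [folklore] -/
def FS2 (x y : ℝ) : ℝ :=
  (-(1 - y + x) ^ 2 * (2 + y - x) / 3) * betS x y - √(HS x y) * (2 * y + 3 * x) / 48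
    - (13 + 9 * x ^ 2) / 48 * arcsin ((2 * y - x) / (√3 * √(1 - x ^ 2)))
    - 2 / 3 * arcsin ((2 * (2 - x) - (2 * x - 1) ^ 2 / (1 + y - x)) / (2 * √3 * √(1 - x ^ 2)))

/-- Antiderivative of `(A+B+C)·√H_S = (3 - 2x² - 2y² + 2xy)√H_S` in `y`. [folklore] -/
def FS4 (x y : ℝ) : ℝ :=
  (2 * y - x) / 16 * (HS x y * √(HS x y))
    + (9 * (1 - x ^ 2) + 12) / 8 * ((2 * y - x) / 4 * √(HS x y)
      + 3 * (1 - x ^ 2) / 4 * arcsin ((2 * y - x) / (√3 * √(1 - x ^ 2))))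

section derivs2

variable {x y : ℝ} (hx0 : 1 / 2 < x) (hx1 : x < 1) (hy0 : 1 / 2 < y) (hyb : y < yb x)
include hx0 hx1 hy0 hyb

/-- Auxiliary step of the contact lens-pair computation (see the module docstring). [folklore] -/
theorem hasDerivAt_FS3 : HasDerivAt (fun y => FS3 x y) ((1 - y ^ 2) * gamS x y) y := by
  have hy1 := y_lt_one hx0 hx1 hyb
  have hH := HS_pos hx0 hx1 hy0 hyb
  have hr : 0 < √(HS x y) := sqrt_pos.mpr hH
  have er : √(HS x y) ^ 2 = HS x y := sq_sqrt hH.le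
  have hy : (0:ℝ) < 1 + y := by linarith
  have hB : (0:ℝ) < 1 - y ^ 2 := by nlinarith
  have hv : HasDerivAt (fun y : ℝ => y - y ^ 3 / 3 - 2 / 3) (1 - y ^ 2) y := by
    have h := ((hasDerivAt_id' y).sub (((hasDerivAt_id' y).pow 3).div_const 3)).sub_const (2 / 3)
    refine h.congr_deriv ?_; simp
  have hl : HasDerivAt (fun y : ℝ => 5 * x - 2 * y) (-2) y := by
    simpa using ((hasDerivAt_id' y).const_mul 2).const_sub (5 * x)
  have h := (((hv.mul (hasDerivAt_gamS hx0 hx1 hy0 hyb)).add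
    (((hasDerivAt_rS hx0 hx1 hy0 hyb).mul hl).div_const 48)).sub
    ((hasDerivAt_asnS hx0 hx1 hy0 hyb).const_mul ((13 + 9 * x ^ 2) / 48))).add
    ((hasDerivAt_piS1 hx0 hx1 hy0 hyb).const_mul (2 / 3))
  refine h.congr_deriv ?_
  unfold HS at er hr ⊢
  field_simp
  grind

/-- Auxiliary step of the contact lens-pair computation (see the module docstring). [folklore] -/
theorem hasDerivAt_FS2 : HasDerivAt (fun y => FS2 x y) ((1 - (x - y) ^ 2) * betS x y) y := by
  have hy1 := y_lt_one hx0 hx1 hyb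
  have hH := HS_pos hx0 hx1 hy0 hyb
  have hr : 0 < √(HS x y) := sqrt_pos.mpr hH
  have er : √(HS x y) ^ 2 = HS x y := sq_sqrt hH.le
  have hw : (0:ℝ) < 1 + y - x := by linarith
  have hC : (0:ℝ) < 1 - (x - y) ^ 2 := by nlinarith
  have hv : HasDerivAt (fun y : ℝ => -(1 - y + x) ^ 2 * (2 + y - x) / 3) (1 - (x - y) ^ 2) y := by
    have h1 : HasDerivAt (fun y : ℝ => 1 - y + x) (-1) y := by
      simpa using ((hasDerivAt_id' y).const_sub 1).add_const x
    have h2 : HasDerivAt (fun y : ℝ => 2 + y - x) 1 y := by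
      simpa using ((hasDerivAt_id' y).const_add 2).sub_const x
    have h := (((h1.pow 2).neg).mul h2).div_const 3
    refine h.congr_deriv ?_
    simp only [show (2:ℕ) - 1 = 1 from rfl, pow_one, Pi.neg_apply, Pi.pow_apply]
    push_cast
    ring
  have hl : HasDerivAt (fun y : ℝ => 2 * y + 3 * x) 2 y := by
    simpa using ((hasDerivAt_id' y).const_mul 2).add_const (3 * x)
  have h := (((hv.mul (hasDerivAt_betS hx0 hx1 hy0 hyb)).sub
    (((hasDerivAt_rS hx0 hx1 hy0 hyb).mul hl).div_const 48)).sub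
    ((hasDerivAt_asnS hx0 hx1 hy0 hyb).const_mul ((13 + 9 * x ^ 2) / 48))).sub
    ((hasDerivAt_piS2 hx0 hx1 hy0 hyb).const_mul (2 / 3))
  refine h.congr_deriv ?_
  unfold HS at er hr ⊢
  field_simp
  grind

/-- Auxiliary step of the contact lens-pair computation (see the module docstring). [folklore] -/
theorem hasDerivAt_FS4 : HasDerivAt (fun y => FS4 x y)
    ((3 - 2 * x ^ 2 - 2 * y ^ 2 + 2 * x * y) * √(HS x y)) y := by
  have hH := HS_pos hx0 hx1 hy0 hyb
  have hr : 0 < √(HS x y) := sqrt_pos.mpr hH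
  have er : √(HS x y) ^ 2 = HS x y := sq_sqrt hH.le
  have hl : HasDerivAt (fun y : ℝ => 2 * y - x) 2 y := by
    simpa using ((hasDerivAt_id' y).const_mul 2).sub_const x
  have hHd : HasDerivAt (fun y => HS x y) (-(4 * (2 * y ^ (2 - 1) * 1)) + 4 * x * 1) y := by
    unfold HS
    exact ((((hasDerivAt_id' y).pow 2).const_mul 4).const_sub (3 - 4 * x ^ 2)).add
      ((hasDerivAt_id' y).const_mul (4 * x))
  have hrd := hasDerivAt_rS hx0 hx1 hy0 hyb
  have h := ((hl.div_const 16).mul (hHd.mul hrd)).add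
    ((((hl.div_const 4).mul hrd).add
      ((hasDerivAt_asnS hx0 hx1 hy0 hyb).const_mul (3 * (1 - x ^ 2) / 4))).const_mul
      ((9 * (1 - x ^ 2) + 12) / 8))
  refine h.congr_deriv ?_
  simp only [show (2:ℕ) - 1 = 1 from rfl, pow_one, Pi.mul_apply]
  unfold HS at er hr ⊢
  field_simp
  grind

end derivs2

/-! ### Case S: kernel, antiderivative, degenerate region -/

/-- Symmetrised case-S kernel `2AC·β + AB·γ − (A+B+C)√H/4` (`A = 1-x²`, `B = 1-y²`,
`C = 1-(x-y)²`, `H = 3-4x²-4y²+4xy`). [folklore] -/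
def kS (x y : ℝ) : ℝ :=
  2 * (1 - x ^ 2) * (1 - (x - y) ^ 2) * betS x y + (1 - x ^ 2) * (1 - y ^ 2) * gamS x y
    - ((1 - x ^ 2) + (1 - y ^ 2) + (1 - (x - y) ^ 2)) * √(HS x y) / 4

/-- `y`-antiderivative of `kS x` on `(1/2, y_b)`. [folklore] -/
def FS (x y : ℝ) : ℝ := 2 * (1 - x ^ 2) * FS2 x y + (1 - x ^ 2) * FS3 x y - FS4 x y / 4

/-- Auxiliary step of the contact lens-pair computation (see the module docstring). [folklore] -/
theorem hasDerivAt_FS {x y : ℝ} (hx0 : 1 / 2 < x) (hx1 : x < 1) (hy0 : 1 / 2 < y) (hyb : y < yb x) :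
    HasDerivAt (fun y => FS x y) (kS x y) y := by
  have h := (((hasDerivAt_FS2 hx0 hx1 hy0 hyb).const_mul (2 * (1 - x ^ 2))).add
    ((hasDerivAt_FS3 hx0 hx1 hy0 hyb).const_mul (1 - x ^ 2))).sub
    ((hasDerivAt_FS4 hx0 hx1 hy0 hyb).div_const 4)
  refine h.congr_deriv ?_
  simp only [kS]; ring

section degenerate
variable {x y : ℝ} (hx0 : 1 / 2 < x) (hx1 : x < 1) (hyb : yb x ≤ y) (hy1 : y ≤ 1)
include hx0 hx1 hyb hy1

omit hx0 hx1 hy1 in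
/-- Auxiliary step of the contact lens-pair computation (see the module docstring). [folklore] -/
theorem two_y_sub_x_ge : √3 * √(1 - x ^ 2) ≤ 2 * y - x := by unfold yb at hyb; linarith

omit hx1 hy1 in
/-- Auxiliary step of the contact lens-pair computation (see the module docstring). [folklore] -/
theorem y_pos_of_ge : 0 < y := by
  have := two_y_sub_x_ge hyb
  have : 0 ≤ √3 * √(1 - x ^ 2) := by positivity
  linarith

omit hy1 in
/-- Auxiliary step of the contact lens-pair computation (see the module docstring). [folklore] -/
theorem HS_nonpos : HS x y ≤ 0 := by
  have hA : 0 ≤ 1 - x ^ 2 := by nlinarith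
  have h1 := two_y_sub_x_ge hyb
  have h0 : 0 ≤ √3 * √(1 - x ^ 2) := by positivity
  have h3 : (√3 * √(1 - x ^ 2)) ^ 2 ≤ (2 * y - x) ^ 2 := pow_le_pow_left₀ h0 h1 2
  rw [mul_pow, sq_sqrt (by norm_num), sq_sqrt hA] at h3
  rw [HS_eq]; linarith

omit hy1 in
/-- Auxiliary step of the contact lens-pair computation (see the module docstring). [folklore] -/
theorem sqrt_HS_eq_zero : √(HS x y) = 0 := sqrt_eq_zero'.mpr (HS_nonpos hx0 hx1 hyb)

omit hy1 in
/-- beyond `y_b`, `2xy ≥ 1` [folklore] -/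
theorem two_xy_ge_one : 1 ≤ 2 * x * y := by
  have hA : 0 ≤ 1 - x ^ 2 := by nlinarith
  have h1 := two_y_sub_x_ge hyb
  have hsA : √(1 - x ^ 2) ≤ √3 * x := by
    rw [show √3 * x = √(3 * x ^ 2) by rw [sqrt_mul (by norm_num), sqrt_sq (by linarith)]]
    exact sqrt_le_sqrt (by nlinarith)
  have h3 : (0:ℝ) ≤ √3 := sqrt_nonneg 3
  have e3 : √3 * √3 = (3:ℝ) := mul_self_sqrt (by norm_num)
  -- 2xy - 1 ≥ x(2y - x) - (1 - x²) ≥ x √3 √A - √A·√A... use √A ≤ √3 x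
  have hApos : 0 ≤ √(1 - x ^ 2) := sqrt_nonneg _
  have eA : √(1 - x ^ 2) * √(1 - x ^ 2) = 1 - x ^ 2 := mul_self_sqrt hA
  nlinarith [mul_le_mul_of_nonneg_left h1 (by linarith : (0:ℝ) ≤ x),
    mul_le_mul_of_nonneg_left hsA hApos]

/-- Auxiliary step of the contact lens-pair computation (see the module docstring). [folklore] -/
theorem gamS_eq_pi (hy1' : y < 1) : gamS x y = π := by
  unfold gamS
  apply arccos_of_le_neg_one
  have hA : 0 < 1 - x ^ 2 := by nlinarith
  have hy0 := y_pos_of_ge hx0 hyb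
  have hB : 0 < 1 - y ^ 2 := by nlinarith
  have hsA : 0 < √(1 - x ^ 2) := sqrt_pos.mpr hA
  have hsB : 0 < √(1 - y ^ 2) := sqrt_pos.mpr hB
  rw [div_le_iff₀ (by positivity)]
  -- need 1 - 2xy ≤ -(2 √A √B), i.e. 2√(AB) ≤ 2xy - 1
  have hH := HS_nonpos hx0 hx1 hyb
  have h2 := two_xy_ge_one hx0 hx1 hyb
  have key : 2 * (√(1 - x ^ 2) * √(1 - y ^ 2)) ≤ 2 * x * y - 1 := by
    have h4 : (2 * (√(1 - x ^ 2) * √(1 - y ^ 2))) ^ 2 ≤ (2 * x * y - 1) ^ 2 := by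
      rw [mul_pow, mul_pow, sq_sqrt hA.le, sq_sqrt hB.le]; unfold HS at hH; nlinarith
    exact (pow_le_pow_iff_left₀ (by positivity) (by linarith) two_ne_zero).mp h4
  linarith

/-- Auxiliary step of the contact lens-pair computation (see the module docstring). [folklore] -/
theorem betS_eq_zero : betS x y = 0 := by
  unfold betS
  apply arccos_of_one_le
  have hA : 0 < 1 - x ^ 2 := by nlinarith
  have hy0 := y_pos_of_ge hx0 hyb
  have hC : 0 < 1 - (x - y) ^ 2 := by nlinarith
  have hsA : 0 < √(1 - x ^ 2) := sqrt_pos.mpr hA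
  have hsC : 0 < √(1 - (x - y) ^ 2) := sqrt_pos.mpr hC
  rw [le_div_iff₀ (by positivity), one_mul]
  have hH := HS_nonpos hx0 hx1 hyb
  have hN : 0 ≤ 1 + 2 * x * y - 2 * x ^ 2 := by
    have := two_y_sub_x_ge hyb
    have : 0 ≤ √3 * √(1 - x ^ 2) := by positivity
    nlinarith
  have h4 : (2 * (√(1 - x ^ 2) * √(1 - (x - y) ^ 2))) ^ 2 ≤ (1 + 2 * x * y - 2 * x ^ 2) ^ 2 := by
    rw [mul_pow, mul_pow, sq_sqrt hA.le, sq_sqrt hC.le]; unfold HS at hH; nlinarith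
  exact (pow_le_pow_iff_left₀ (by positivity) hN two_ne_zero).mp h4

/-- Beyond `y_b` the kernel is `π·A·B`. [folklore] -/
theorem kS_eq_of_ge : kS x y = π * ((1 - x ^ 2) * (1 - y ^ 2)) := by
  unfold kS
  rw [betS_eq_zero hx0 hx1 hyb hy1, sqrt_HS_eq_zero hx0 hx1 hyb]
  rcases lt_or_eq_of_le hy1 with h | h
  · rw [gamS_eq_pi hx0 hx1 hyb hy1 h]; ring
  · subst h; simp

end degenerate

/-! ### Case S: the two pole-term identities at `y = 1/2` -/

/-- `asn₂(x) = arcsin((4x - 1)/3)`. [folklore] -/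
def asn2 (x : ℝ) : ℝ := arcsin ((4 * x - 1) / 3)

section ident
variable {x : ℝ} (hx0 : 1 / 2 < x) (hx1 : x < 1)
include hx0 hx1

/-- Auxiliary step of the contact lens-pair computation (see the module docstring). [folklore] -/
theorem cos_th1 : cos (th1 x) = √(1 - x) / (√3 * √(1 + x)) := by
  unfold th1
  have hx : 0 < 1 + x := by linarith
  rw [cos_arccos (by linarith [sqrt_nonneg ((1 - x) / (3 * (1 + x)))])]
  · rw [sqrt_div (by linarith), sqrt_mul (by norm_num)]
  · rw [sqrt_le_one, div_le_one (by positivity)]; linarith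

/-- Auxiliary step of the contact lens-pair computation (see the module docstring). [folklore] -/
theorem sin_th1 : sin (th1 x) = √2 * √(1 + 2 * x) / (√3 * √(1 + x)) := by
  unfold th1
  have hx : 0 < 1 + x := by linarith
  rw [sin_arccos, sq_sqrt (by positivity)]
  have : 1 - (1 - x) / (3 * (1 + x)) = (2 * (1 + 2 * x)) / (3 * (1 + x)) := by field_simp; ring
  rw [this, sqrt_div (by linarith), sqrt_mul (by norm_num), sqrt_mul (by norm_num)]

/-- Auxiliary step of the contact lens-pair computation (see the module docstring). [folklore] -/
theorem cos_th2 : cos (th2 x) = √(1 - x) * √(1 + 2 * x) / (√(1 + x) * √(3 - 2 * x)) := by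
  unfold th2
  have hx : 0 < 1 + x := by linarith
  have h1 : 0 < √(1 + x) := sqrt_pos.mpr hx
  have h2 : 0 < √(3 - 2 * x) := sqrt_pos.mpr (by linarith)
  have hnn : 0 ≤ √(1 - x) * √(1 + 2 * x) / (√(1 + x) * √(3 - 2 * x)) := by positivity
  rw [cos_arccos (by linarith)]
  rw [div_le_one (by positivity)]
  have h4 : (√(1 - x) * √(1 + 2 * x)) ^ 2 ≤ (√(1 + x) * √(3 - 2 * x)) ^ 2 := by
    rw [mul_pow, mul_pow, sq_sqrt (by linarith), sq_sqrt (by linarith), sq_sqrt (by linarith),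
      sq_sqrt (by linarith)]; nlinarith
  exact (pow_le_pow_iff_left₀ (by positivity) (by positivity) two_ne_zero).mp h4

/-- Auxiliary step of the contact lens-pair computation (see the module docstring). [folklore] -/
theorem sin_th2 : sin (th2 x) = √2 / (√(1 + x) * √(3 - 2 * x)) := by
  unfold th2
  have hx : 0 < 1 + x := by linarith
  have h1 : 0 < √(1 + x) := sqrt_pos.mpr hx
  have h2 : 0 < √(3 - 2 * x) := sqrt_pos.mpr (by linarith)
  rw [sin_arccos]
  have hne : (1 + x) * (3 - 2 * x) ≠ 0 := (mul_pos hx (by linarith : (0:ℝ) < 3 - 2 * x)).ne'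
  have : 1 - (√(1 - x) * √(1 + 2 * x) / (√(1 + x) * √(3 - 2 * x))) ^ 2 =
      2 / ((1 + x) * (3 - 2 * x)) := by
    rw [div_pow, mul_pow, mul_pow, sq_sqrt (by linarith), sq_sqrt (by linarith), sq_sqrt (by linarith),
      sq_sqrt (by linarith), eq_div_iff hne, sub_mul, div_mul_cancel₀ _ hne]
    ring
  rw [this, sqrt_div (by norm_num), sqrt_mul (by linarith)]

/-- Auxiliary step of the contact lens-pair computation (see the module docstring). [folklore] -/
theorem sin_asn2 : sin (asn2 x) = (4 * x - 1) / 3 := by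
  unfold asn2; rw [sin_arcsin (by linarith) (by linarith)]

/-- Auxiliary step of the contact lens-pair computation (see the module docstring). [folklore] -/
theorem cos_asn2 : cos (asn2 x) = 2 * √2 * (√(1 - x) * √(1 + 2 * x)) / 3 := by
  unfold asn2
  rw [cos_arcsin]
  have : 1 - ((4 * x - 1) / 3) ^ 2 = (8 * ((1 - x) * (1 + 2 * x))) / 9 := by ring
  rw [this, sqrt_div (by nlinarith), show (9:ℝ) = 3 ^ 2 by norm_num, sqrt_sq (by norm_num),
    sqrt_mul (by norm_num), sqrt_mul (by linarith), show (8:ℝ) = 2 ^ 2 * 2 by norm_num,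
    sqrt_mul (by norm_num), sqrt_sq (by norm_num)]

omit hx0 hx1 in
/-- Auxiliary step of the contact lens-pair computation (see the module docstring). [folklore] -/
theorem th1_le : th1 x ≤ π / 2 := arccos_le_pi_div_two.mpr (sqrt_nonneg _)

omit hx0 hx1 in
/-- Auxiliary step of the contact lens-pair computation (see the module docstring). [folklore] -/
theorem th1_nonneg : 0 ≤ th1 x := arccos_nonneg _

/-- Auxiliary step of the contact lens-pair computation (see the module docstring). [folklore] -/
theorem th2_le : th2 x ≤ π / 2 := by
  unfold th2; apply arccos_le_pi_div_two.mpr; positivity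

omit hx0 hx1 in
/-- Auxiliary step of the contact lens-pair computation (see the module docstring). [folklore] -/
theorem th2_nonneg : 0 ≤ th2 x := arccos_nonneg _

omit hx1 in
/-- Auxiliary step of the contact lens-pair computation (see the module docstring). [folklore] -/
theorem asn2_nonneg : 0 ≤ asn2 x := arcsin_nonneg.mpr (by linarith)

omit hx0 hx1 in
/-- Auxiliary step of the contact lens-pair computation (see the module docstring). [folklore] -/
theorem asn2_le : asn2 x ≤ π / 2 := arcsin_le_pi_div_two _

/-- `arccos(1/3) ≤ θ₁(x)` for `x ≥ 1/2`. [folklore] -/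
theorem arccos_third_le_th1 : arccos (1 / 3) ≤ th1 x := by
  unfold th1
  apply arccos_le_arccos
  have hx : 0 < 1 + x := by linarith
  rw [show (1:ℝ) / 3 = √((1 / 3) ^ 2) by rw [sqrt_sq (by norm_num)]]
  apply sqrt_le_sqrt
  rw [div_le_iff₀ (by positivity)]; nlinarith

/-- `π - arccos(1/3) ≤ 2θ₂(x)` for `x ≥ 1/2` (via `2θ₂ = arccos(2cos²θ₂ - 1)`). [folklore] -/
theorem two_th2_ge : π - arccos (1 / 3) ≤ 2 * th2 x := by
  have hc := cos_th2 hx0 hx1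
  have h2t : 2 * th2 x = arccos (2 * cos (th2 x) ^ 2 - 1) := by
    rw [← cos_two_mul, arccos_cos (by linarith [th2_nonneg (x := x)])
      (by linarith [th2_le hx0 hx1])]
  rw [h2t, ← arccos_neg]
  apply arccos_le_arccos
  rw [hc, div_pow, mul_pow, mul_pow, sq_sqrt (by linarith), sq_sqrt (by linarith), sq_sqrt (by linarith),
    sq_sqrt (by linarith)]
  have hx : 0 < 1 + x := by linarith
  have h3 : 0 < 3 - 2 * x := by linarith
  have hne : (1 + x) * (3 - 2 * x) ≠ 0 := (mul_pos hx h3).ne'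
  rw [show 2 * ((1 - x) * (1 + 2 * x) / ((1 + x) * (3 - 2 * x))) - 1 =
    (2 * ((1 - x) * (1 + 2 * x)) - (1 + x) * (3 - 2 * x)) / ((1 + x) * (3 - 2 * x)) by
      rw [eq_div_iff hne, sub_mul, mul_assoc, div_mul_cancel₀ _ hne, one_mul],
    div_le_iff₀ (by positivity)]
  nlinarith

/-- The `(1+y)`-pole term at `y = 1/2`: `arcsin(ω-argument) = θ₁ − asn₂`. [folklore] -/
theorem piS1_half :
    arcsin ((2 * (2 + x) - (1 + 2 * x) ^ 2 / (1 + 1 / 2)) / (2 * √3 * √(1 - x ^ 2))) =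
      th1 x - asn2 x := by
  have hx : 0 < 1 + x := by linarith
  have hsx : 0 < √(1 - x) := sqrt_pos.mpr (by linarith)
  have hpx : 0 < √(1 + x) := sqrt_pos.mpr hx
  have htx : 0 < √(1 + 2 * x) := sqrt_pos.mpr (by linarith)
  have h2 : (0:ℝ) < √2 := by positivity
  have h3 : (0:ℝ) < √3 := by positivity
  have esx : √(1 - x) ^ 2 = 1 - x := sq_sqrt (by linarith)
  have epx : √(1 + x) ^ 2 = 1 + x := sq_sqrt (by linarith)
  have etx : √(1 + 2 * x) ^ 2 = 1 + 2 * x := sq_sqrt (by linarith)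
  have e2 : √2 ^ 2 = (2:ℝ) := sq_sqrt (by norm_num)
  have e3 : √3 ^ 2 = (3:ℝ) := sq_sqrt (by norm_num)
  have hsd : sin (th1 x - asn2 x) =
      (2 * (2 + x) - (1 + 2 * x) ^ 2 / (1 + 1 / 2)) / (2 * √3 * √(1 - x ^ 2)) := by
    rw [sin_sub, sin_th1 hx0 hx1, cos_th1 hx0 hx1, sin_asn2 hx0 hx1, cos_asn2 hx0 hx1,
      show 1 - x ^ 2 = (1 - x) * (1 + x) by ring, sqrt_mul (by linarith)]
    field_simp
    grind
  rw [← hsd, arcsin_sin]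
  · linarith [th1_nonneg (x := x), asn2_le (x := x)]
  · linarith [th1_le (x := x), asn2_nonneg hx0]

/-- The `(1+y-x)`-pole term at `y = 1/2`: `arcsin(ω₂-argument) = 3π/2 − θ₁ − 2θ₂`. [folklore] -/
theorem piS2_half :
    arcsin ((2 * (2 - x) - (2 * x - 1) ^ 2 / (1 + 1 / 2 - x)) / (2 * √3 * √(1 - x ^ 2))) =
      3 * π / 2 - th1 x - 2 * th2 x := by
  have hx : 0 < 1 + x := by linarith
  have hw : 0 < 1 + 1 / 2 - x := by linarith
  have hsx : 0 < √(1 - x) := sqrt_pos.mpr (by linarith)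
  have hpx : 0 < √(1 + x) := sqrt_pos.mpr hx
  have htx : 0 < √(1 + 2 * x) := sqrt_pos.mpr (by linarith)
  have hux : 0 < √(3 - 2 * x) := sqrt_pos.mpr (by linarith)
  have h2 : (0:ℝ) < √2 := by positivity
  have h3 : (0:ℝ) < √3 := by positivity
  have esx : √(1 - x) ^ 2 = 1 - x := sq_sqrt (by linarith)
  have epx : √(1 + x) ^ 2 = 1 + x := sq_sqrt (by linarith)
  have etx : √(1 + 2 * x) ^ 2 = 1 + 2 * x := sq_sqrt (by linarith)
  have eux : √(3 - 2 * x) ^ 2 = 3 - 2 * x := sq_sqrt (by linarith)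
  have e2 : √2 ^ 2 = (2:ℝ) := sq_sqrt (by norm_num)
  have e3 : √3 ^ 2 = (3:ℝ) := sq_sqrt (by norm_num)
  have hsd : sin (3 * π / 2 - th1 x - 2 * th2 x) =
      (2 * (2 - x) - (2 * x - 1) ^ 2 / (1 + 1 / 2 - x)) / (2 * √3 * √(1 - x ^ 2)) := by
    have : 3 * π / 2 - th1 x - 2 * th2 x = π / 2 - (th1 x + 2 * th2 x - π) := by ring
    rw [this, sin_pi_div_two_sub, cos_sub_pi, cos_add, cos_two_mul, sin_two_mul,
      sin_th1 hx0 hx1, cos_th1 hx0 hx1, sin_th2 hx0 hx1, cos_th2 hx0 hx1,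
      show 1 - x ^ 2 = (1 - x) * (1 + x) by ring, sqrt_mul (by linarith)]
    field_simp
    grind
  rw [← hsd, arcsin_sin]
  · linarith [th1_le (x := x), th2_le hx0 hx1, pi_pos]
  · linarith [arccos_third_le_th1 hx0 hx1, two_th2_ge hx0 hx1, pi_pos]

end ident

/-! ### Case S: values at `y_b` and `1/2`, continuity, and the inner integral -/

section valuesS
variable {x : ℝ} (hx0 : 1 / 2 < x) (hx1 : x < 1)
include hx0 hx1

omit hx0 hx1 in
/-- Auxiliary step of the contact lens-pair computation (see the module docstring). [folklore] -/
theorem two_yb_sub : 2 * yb x - x = √3 * √(1 - x ^ 2) := by unfold yb; ring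

/-- Auxiliary step of the contact lens-pair computation (see the module docstring). [folklore] -/
theorem HS_yb : HS x (yb x) = 0 := by
  rw [HS_eq, two_yb_sub, mul_pow, sq_sqrt (by norm_num), sq_sqrt (by nlinarith)]; ring

/-- Auxiliary step of the contact lens-pair computation (see the module docstring). [folklore] -/
theorem yb_gt_half : 1 / 2 < yb x := by
  unfold yb
  have : 1 - x < √3 * √(1 - x ^ 2) := by
    rw [← sqrt_mul (by norm_num)]
    calc 1 - x = √((1 - x) ^ 2) := (sqrt_sq (by linarith)).symm
      _ < √(3 * (1 - x ^ 2)) := sqrt_lt_sqrt (sq_nonneg _) (by nlinarith)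
  linarith

/-- Auxiliary step of the contact lens-pair computation (see the module docstring). [folklore] -/
theorem asnS_yb : arcsin ((2 * yb x - x) / (√3 * √(1 - x ^ 2))) = π / 2 := by
  rw [two_yb_sub, div_self, arcsin_one]
  have : 0 < √(1 - x ^ 2) := sqrt_pos.mpr (by nlinarith)
  positivity

/-- Auxiliary step of the contact lens-pair computation (see the module docstring). [folklore] -/
theorem piS1_yb :
    arcsin ((2 * (2 + x) - (1 + 2 * x) ^ 2 / (1 + yb x)) / (2 * √3 * √(1 - x ^ 2))) = π / 2 := by
  have hA : 0 < 1 - x ^ 2 := by nlinarith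
  have hsA : 0 < √(1 - x ^ 2) := sqrt_pos.mpr hA
  have h3 : (0:ℝ) < √3 := by positivity
  have esA : √(1 - x ^ 2) ^ 2 = 1 - x ^ 2 := sq_sqrt hA.le
  have e3 : √3 ^ 2 = (3:ℝ) := sq_sqrt (by norm_num)
  have hy : 0 < 1 + yb x := by linarith [yb_gt_half hx0 hx1]
  rw [show (2 * (2 + x) - (1 + 2 * x) ^ 2 / (1 + yb x)) / (2 * √3 * √(1 - x ^ 2)) = 1 by
    unfold yb at hy ⊢; field_simp; grind, arcsin_one]

/-- Auxiliary step of the contact lens-pair computation (see the module docstring). [folklore] -/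
theorem piS2_yb :
    arcsin ((2 * (2 - x) - (2 * x - 1) ^ 2 / (1 + yb x - x)) / (2 * √3 * √(1 - x ^ 2))) = π / 2 := by
  have hA : 0 < 1 - x ^ 2 := by nlinarith
  have hsA : 0 < √(1 - x ^ 2) := sqrt_pos.mpr hA
  have h3 : (0:ℝ) < √3 := by positivity
  have esA : √(1 - x ^ 2) ^ 2 = 1 - x ^ 2 := sq_sqrt hA.le
  have e3 : √3 ^ 2 = (3:ℝ) := sq_sqrt (by norm_num)
  have hy : 0 < 1 + yb x - x := by linarith [yb_gt_half hx0 hx1]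
  rw [show (2 * (2 - x) - (2 * x - 1) ^ 2 / (1 + yb x - x)) / (2 * √3 * √(1 - x ^ 2)) = 1 by
    unfold yb at hy ⊢; field_simp; grind, arcsin_one]

/-- Auxiliary step of the contact lens-pair computation (see the module docstring). [folklore] -/
theorem gamS_yb : gamS x (yb x) = π := gamS_eq_pi hx0 hx1 le_rfl (yb_lt_one hx0 hx1).le (yb_lt_one hx0 hx1)

/-- Auxiliary step of the contact lens-pair computation (see the module docstring). [folklore] -/
theorem betS_yb : betS x (yb x) = 0 := betS_eq_zero hx0 hx1 le_rfl (yb_lt_one hx0 hx1).le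

/-- Auxiliary step of the contact lens-pair computation (see the module docstring). [folklore] -/
theorem sqrt_HS_yb : √(HS x (yb x)) = 0 := by rw [HS_yb hx0 hx1, sqrt_zero]

/-- Auxiliary step of the contact lens-pair computation (see the module docstring). [folklore] -/
theorem gamS_half : gamS x (1 / 2) = th1 x := by
  unfold gamS th1
  congr 1
  have hx : 0 < 1 + x := by linarith
  have h3 : (0:ℝ) < √3 := by positivity
  have hsx : 0 < √(1 - x) := sqrt_pos.mpr (by linarith)
  have hpx : 0 < √(1 + x) := sqrt_pos.mpr hx
  rw [show (1:ℝ) - (1 / 2) ^ 2 = 3 / 4 by norm_num, sqrt_div (by norm_num), show (4:ℝ) = 2 ^ 2 by norm_num,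
    sqrt_sq (by norm_num), show 1 - x ^ 2 = (1 - x) * (1 + x) by ring, sqrt_mul (by linarith),
    sqrt_div (by linarith), sqrt_mul (by norm_num)]
  rw [div_eq_div_iff (by positivity) (by positivity)]
  have e : √(1 - x) ^ 2 = 1 - x := sq_sqrt (by linarith)
  grind

/-- Auxiliary step of the contact lens-pair computation (see the module docstring). [folklore] -/
theorem betS_half : betS x (1 / 2) = th2 x := by
  unfold betS th2
  congr 1
  have hx : 0 < 1 + x := by linarith
  have hsx : 0 < √(1 - x) := sqrt_pos.mpr (by linarith)
  have hpx : 0 < √(1 + x) := sqrt_pos.mpr hx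
  have htx : 0 < √(1 + 2 * x) := sqrt_pos.mpr (by linarith)
  have hux : 0 < √(3 - 2 * x) := sqrt_pos.mpr (by linarith)
  rw [show 1 - (x - 1 / 2) ^ 2 = ((3 - 2 * x) * (1 + 2 * x)) / 4 by ring, sqrt_div (by nlinarith),
    show (4:ℝ) = 2 ^ 2 by norm_num, sqrt_sq (by norm_num), sqrt_mul (by linarith),
    show 1 - x ^ 2 = (1 - x) * (1 + x) by ring, sqrt_mul (by linarith)]
  rw [div_eq_div_iff (by positivity) (by positivity)]
  have e1 : √(1 - x) ^ 2 = 1 - x := sq_sqrt (by linarith)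
  have e2 : √(1 + 2 * x) ^ 2 = 1 + 2 * x := sq_sqrt (by linarith)
  grind

/-- Auxiliary step of the contact lens-pair computation (see the module docstring). [folklore] -/
theorem asnS_half : arcsin ((2 * (1 / 2) - x) / (√3 * √(1 - x ^ 2))) = π / 2 - th1 x := by
  rw [arcsin_eq_pi_div_two_sub_arccos, th1]
  congr 2
  have hx : 0 < 1 + x := by linarith
  have h3 : (0:ℝ) < √3 := by positivity
  have hsx : 0 < √(1 - x) := sqrt_pos.mpr (by linarith)
  have hpx : 0 < √(1 + x) := sqrt_pos.mpr hx
  rw [show 1 - x ^ 2 = (1 - x) * (1 + x) by ring, sqrt_mul (by linarith),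
    sqrt_div (by linarith), sqrt_mul (by norm_num)]
  rw [div_eq_div_iff (by positivity) (by positivity)]
  have e : √(1 - x) ^ 2 = 1 - x := sq_sqrt (by linarith)
  grind

omit hx0 in
/-- Auxiliary step of the contact lens-pair computation (see the module docstring). [folklore] -/
theorem sqrt_HS_half : √(HS x (1 / 2)) = √2 * (√(1 - x) * √(1 + 2 * x)) := by
  rw [show HS x (1 / 2) = 2 * ((1 - x) * (1 + 2 * x)) by unfold HS; ring, sqrt_mul (by norm_num),
    sqrt_mul (by linarith)]

end valuesS

/-- The case-S outer integrand `h_S(x) = ∫_{1/2}^1 kS x y dy`. [folklore] -/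
def hS (x : ℝ) : ℝ :=
  5 * π / 3 * (1 - x ^ 2) - (1 - x ^ 2) * (1189 + 135 * x ^ 2) / 384 * th1 x
    - (1 - x ^ 2) * (8 * x ^ 3 - 12 * x ^ 2 - 18 * x + 27) / 12 * th2 x
    + 2 / 3 * (1 - x ^ 2) * asn2 x
    + √2 / 384 * (1 - x) * (99 + 44 * x - 43 * x ^ 2) * (√(1 - x) * √(1 + 2 * x))

/-- Auxiliary step of the contact lens-pair computation (see the module docstring). [folklore] -/
theorem FS_eval {x : ℝ} (hx0 : 1 / 2 < x) (hx1 : x < 1) :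
    FS x (yb x) - FS x (1 / 2) + π * (1 - x ^ 2) * (2 / 3 - (yb x - yb x ^ 3 / 3)) = hS x := by
  have hsx : 0 < √(1 - x) := sqrt_pos.mpr (by linarith)
  have h2 : (0:ℝ) < √2 := by positivity
  have e2 : √2 ^ 2 = (2:ℝ) := sq_sqrt (by norm_num)
  unfold FS FS2 FS3 FS4 hS
  rw [gamS_yb hx0 hx1, betS_yb hx0 hx1, sqrt_HS_yb hx0 hx1, asnS_yb hx0 hx1, piS1_yb hx0 hx1,
    piS2_yb hx0 hx1, gamS_half hx0 hx1, betS_half hx0 hx1, asnS_half hx0 hx1, piS1_half hx0 hx1,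
    piS2_half hx0 hx1, sqrt_HS_half hx1, HS_yb hx0 hx1,
    show HS x (1 / 2) = 2 * ((1 - x) * (1 + 2 * x)) by unfold HS; ring]
  field_simp
  ring

section contS
variable {x : ℝ} (hx0 : 1 / 2 < x) (hx1 : x < 1)
include hx0 hx1

/-- Auxiliary step of the contact lens-pair computation (see the module docstring). [folklore] -/
theorem continuousOn_gamS : ContinuousOn (fun y => gamS x y) (Icc (1 / 2) (yb x)) := by
  unfold gamS
  refine continuous_arccos.comp_continuousOn (ContinuousOn.div (by fun_prop) (by fun_prop) ?_)
  intro y hy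
  have hyb := yb_lt_one hx0 hx1
  have : 0 < √(1 - x ^ 2) := sqrt_pos.mpr (by nlinarith)
  have : 0 < √(1 - y ^ 2) := sqrt_pos.mpr (by nlinarith [hy.1, hy.2])
  positivity

/-- Auxiliary step of the contact lens-pair computation (see the module docstring). [folklore] -/
theorem continuousOn_betS : ContinuousOn (fun y => betS x y) (Icc (1 / 2) (yb x)) := by
  unfold betS
  refine continuous_arccos.comp_continuousOn (ContinuousOn.div (by fun_prop) (by fun_prop) ?_)
  intro y hy
  have hyb := yb_lt_one hx0 hx1
  have : 0 < √(1 - x ^ 2) := sqrt_pos.mpr (by nlinarith)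
  have : 0 < √(1 - (x - y) ^ 2) := sqrt_pos.mpr (by nlinarith [hy.1, hy.2])
  positivity

omit hx0 hx1 in
/-- Auxiliary step of the contact lens-pair computation (see the module docstring). [folklore] -/
theorem continuous_sqrtHS : Continuous fun y => √(HS x y) := by unfold HS; fun_prop

omit hx0 hx1 in
/-- Auxiliary step of the contact lens-pair computation (see the module docstring). [folklore] -/
theorem continuous_asnS : Continuous fun y => arcsin ((2 * y - x) / (√3 * √(1 - x ^ 2))) :=
  continuous_arcsin.comp (by fun_prop)

omit hx0 hx1 in
/-- Auxiliary step of the contact lens-pair computation (see the module docstring). [folklore] -/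
theorem continuousOn_piS1 : ContinuousOn
    (fun y => arcsin ((2 * (2 + x) - (1 + 2 * x) ^ 2 / (1 + y)) / (2 * √3 * √(1 - x ^ 2))))
    (Icc (1 / 2) (yb x)) := by
  refine continuous_arcsin.comp_continuousOn (ContinuousOn.div_const ?_ _)
  refine continuousOn_const.sub (ContinuousOn.div continuousOn_const (by fun_prop) ?_)
  intro y hy; have := hy.1; positivity

omit hx0 in
/-- Auxiliary step of the contact lens-pair computation (see the module docstring). [folklore] -/
theorem continuousOn_piS2 : ContinuousOn
    (fun y => arcsin ((2 * (2 - x) - (2 * x - 1) ^ 2 / (1 + y - x)) / (2 * √3 * √(1 - x ^ 2))))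
    (Icc (1 / 2) (yb x)) := by
  refine continuous_arcsin.comp_continuousOn (ContinuousOn.div_const ?_ _)
  refine continuousOn_const.sub (ContinuousOn.div continuousOn_const (by fun_prop) ?_)
  intro y hy; have := hy.1; intro h; linarith

/-- Auxiliary step of the contact lens-pair computation (see the module docstring). [folklore] -/
theorem continuousOn_FS : ContinuousOn (fun y => FS x y) (Icc (1 / 2) (yb x)) := by
  have h1 := continuousOn_gamS hx0 hx1
  have h2 := continuousOn_betS hx0 hx1
  have h3 := (continuous_sqrtHS (x := x)).continuousOn (s := Icc (1 / 2) (yb x))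
  have h4 := (continuous_asnS (x := x)).continuousOn (s := Icc (1 / 2) (yb x))
  have h5 := continuousOn_piS1 (x := x)
  have h6 := continuousOn_piS2 (x := x) hx1
  have hH : Continuous fun y => HS x y := by unfold HS; fun_prop
  unfold FS FS2 FS3 FS4
  apply ContinuousOn.sub
  · apply ContinuousOn.add
    · apply ContinuousOn.mul continuousOn_const
      apply ContinuousOn.sub
      · apply ContinuousOn.sub
        · exact ContinuousOn.sub (ContinuousOn.mul (by fun_prop) h2)
            (ContinuousOn.div_const (ContinuousOn.mul h3 (by fun_prop)) _)
        · exact ContinuousOn.mul continuousOn_const h4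
      · exact ContinuousOn.mul continuousOn_const h6
    · apply ContinuousOn.mul continuousOn_const
      apply ContinuousOn.add
      · apply ContinuousOn.sub
        · exact ContinuousOn.add (ContinuousOn.mul (by fun_prop) h1)
            (ContinuousOn.div_const (ContinuousOn.mul h3 (by fun_prop)) _)
        · exact ContinuousOn.mul continuousOn_const h4
      · exact ContinuousOn.mul continuousOn_const h5
  · apply ContinuousOn.div_const
    apply ContinuousOn.add
    · exact ContinuousOn.mul (by fun_prop) (ContinuousOn.mul hH.continuousOn h3)
    · apply ContinuousOn.mul continuousOn_const
      exact ContinuousOn.add (ContinuousOn.mul (by fun_prop) h3) (ContinuousOn.mul continuousOn_const h4)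

/-- Auxiliary step of the contact lens-pair computation (see the module docstring). [folklore] -/
theorem continuousOn_kS : ContinuousOn (fun y => kS x y) (Icc (1 / 2) (yb x)) := by
  have h1 := continuousOn_gamS hx0 hx1
  have h2 := continuousOn_betS hx0 hx1
  have h3 := (continuous_sqrtHS (x := x)).continuousOn (s := Icc (1 / 2) (yb x))
  unfold kS
  apply ContinuousOn.sub
  · apply ContinuousOn.add
    · exact ContinuousOn.mul (by fun_prop) h2
    · exact ContinuousOn.mul (by fun_prop) h1
  · exact ContinuousOn.div_const (ContinuousOn.mul (by fun_prop) h3) _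

/-- the tail `∫_{y_b}^1 kS = πA(2/3 − P(y_b))` [folklore] -/
theorem integral_kS_tail :
    ∫ y in (yb x)..1, kS x y = π * (1 - x ^ 2) * (2 / 3 - (yb x - yb x ^ 3 / 3)) := by
  have hyb1 := yb_lt_one hx0 hx1
  have heq : EqOn (fun y => kS x y) (fun y => π * ((1 - x ^ 2) * (1 - y ^ 2))) (uIcc (yb x) 1) := by
    intro y hy
    rw [uIcc_of_le hyb1.le] at hy
    exact kS_eq_of_ge hx0 hx1 hy.1 hy.2
  rw [integral_congr heq]
  have hderiv : ∀ y ∈ uIcc (yb x) 1,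
      HasDerivAt (fun y => π * ((1 - x ^ 2) * (y - y ^ 3 / 3))) (π * ((1 - x ^ 2) * (1 - y ^ 2))) y := by
    intro y _
    have h := ((hasDerivAt_id' y).sub (((hasDerivAt_id' y).pow 3).div_const 3)).const_mul
      (1 - x ^ 2) |>.const_mul π
    refine h.congr_deriv ?_
    simp only [show (3:ℕ) - 1 = 2 from rfl]; ring
  rw [integral_eq_sub_of_hasDerivAt hderiv ((by fun_prop : Continuous fun y : ℝ =>
    π * ((1 - x ^ 2) * (1 - y ^ 2))).intervalIntegrable _ _)]
  ring

/-- **Case S inner integral in closed form**: `∫_{1/2}^1 kS x y dy = hS x` for `x ∈ (1/2, 1)`.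
[folklore] -/
theorem integral_kS : ∫ y in (1 / 2 : ℝ)..1, kS x y = hS x := by
  have hyb1 := yb_lt_one hx0 hx1
  have hybh := yb_gt_half hx0 hx1
  have hint1 : IntervalIntegrable (fun y => kS x y) volume (1 / 2) (yb x) :=
    (continuousOn_kS hx0 hx1).intervalIntegrable_of_Icc hybh.le
  have hint2 : IntervalIntegrable (fun y => kS x y) volume (yb x) 1 := by
    apply ContinuousOn.intervalIntegrable_of_Icc hyb1.le
    apply ContinuousOn.congr (f := fun y => π * ((1 - x ^ 2) * (1 - y ^ 2))) (by fun_prop)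
    intro y hy
    exact kS_eq_of_ge hx0 hx1 hy.1 hy.2
  rw [← integral_add_adjacent_intervals hint1 hint2, integral_kS_tail hx0 hx1,
    integral_eq_sub_of_hasDerivAt_of_le hybh.le (continuousOn_FS hx0 hx1)
      (fun y hy => hasDerivAt_FS hx0 hx1 hy.1 hy.2) hint1]
  exact FS_eval hx0 hx1

end contS

/-- `q(x) = √(1-x)√(1+2x) = √Q₂(x)`. [folklore] -/
def qx (x : ℝ) : ℝ := √(1 - x) * √(1 + 2 * x)

/-- generic sextic `a₀ + a₁x + ⋯ + a₆x⁶` [folklore] -/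
def P6 (a0 a1 a2 a3 a4 a5 a6 x : ℝ) : ℝ :=
  a0 + a1 * x + a2 * x ^ 2 + a3 * x ^ 3 + a4 * x ^ 4 + a5 * x ^ 5 + a6 * x ^ 6

/-- Auxiliary step of the contact lens-pair computation (see the module docstring). [folklore] -/
theorem hasDerivAt_P6 (a0 a1 a2 a3 a4 a5 a6 x : ℝ) :
    HasDerivAt (fun x => P6 a0 a1 a2 a3 a4 a5 a6 x)
      (a1 + 2 * a2 * x + 3 * a3 * x ^ 2 + 4 * a4 * x ^ 3 + 5 * a5 * x ^ 4 + 6 * a6 * x ^ 5) x := by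
  unfold P6
  have h1 := hasDerivAt_id' x
  have h := ((((((hasDerivAt_const x a0).add (h1.const_mul a1)).add ((h1.pow 2).const_mul a2)).add
    ((h1.pow 3).const_mul a3)).add ((h1.pow 4).const_mul a4)).add ((h1.pow 5).const_mul a5)).add
    ((h1.pow 6).const_mul a6)
  refine h.congr_deriv ?_
  push_cast
  ring

section atoms
variable {x : ℝ} (hx0 : 1 / 2 < x) (hx1 : x < 1)
include hx0 hx1

/-- Auxiliary step of the contact lens-pair computation (see the module docstring). [folklore] -/
theorem qx_pos : 0 < qx x := by
  unfold qx; exact mul_pos (sqrt_pos.mpr (by linarith)) (sqrt_pos.mpr (by linarith))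

/-- Auxiliary step of the contact lens-pair computation (see the module docstring). [folklore] -/
theorem hasDerivAt_qx : HasDerivAt qx ((1 - 4 * x) / (2 * qx x)) x := by
  have hs : 0 < √(1 - x) := sqrt_pos.mpr (by linarith)
  have ht : 0 < √(1 + 2 * x) := sqrt_pos.mpr (by linarith)
  have es : √(1 - x) ^ 2 = 1 - x := sq_sqrt (by linarith)
  have et : √(1 + 2 * x) ^ 2 = 1 + 2 * x := sq_sqrt (by linarith)
  have h1 : HasDerivAt (fun x => √(1 - x)) (-1 / (2 * √(1 - x))) x := by
    have := ((hasDerivAt_id' x).const_sub 1).sqrt (by linarith)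
    simpa using this
  have h2 : HasDerivAt (fun x => √(1 + 2 * x)) (2 / (2 * √(1 + 2 * x))) x := by
    have := (((hasDerivAt_id' x).const_mul 2).const_add 1).sqrt (by linarith)
    simpa using this
  have h := h1.mul h2
  have h' : HasDerivAt qx (-1 / (2 * √(1 - x)) * √(1 + 2 * x) + √(1 - x) * (2 / (2 * √(1 + 2 * x)))) x := h
  refine h'.congr_deriv ?_
  unfold qx
  field_simp
  grind

omit hx0 in
/-- Auxiliary step of the contact lens-pair computation (see the module docstring). [folklore] -/
theorem hasDerivAt_sqrt_one_sub : HasDerivAt (fun x => √(1 - x)) (-1 / (2 * √(1 - x))) x := by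
  have := ((hasDerivAt_id' x).const_sub 1).sqrt (by linarith)
  simpa using this

/-- Auxiliary step of the contact lens-pair computation (see the module docstring). [folklore] -/
theorem hasDerivAt_asn2 : HasDerivAt asn2 (√2 / qx x) x := by
  have hl : HasDerivAt (fun x : ℝ => (4 * x - 1) / 3) (4 / 3) x := by
    have h := (((hasDerivAt_id' x).const_mul 4).sub_const 1).div_const 3
    exact h.congr_deriv (by norm_num)
  have hne1 : (4 * x - 1) / 3 ≠ -1 := by intro h; linarith
  have hne2 : (4 * x - 1) / 3 ≠ 1 := by intro h; linarith
  have h := (hasDerivAt_arcsin hne1 hne2).comp x hl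
  have h2 : HasDerivAt asn2 (1 / √(1 - ((4 * x - 1) / 3) ^ 2) * (4 / 3)) x := h
  refine h2.congr_deriv ?_
  have hkey : √(1 - ((4 * x - 1) / 3) ^ 2) = 2 * √2 * qx x / 3 := by
    have : 1 - ((4 * x - 1) / 3) ^ 2 = (8 / 9) * ((1 - x) * (1 + 2 * x)) := by ring
    rw [this, sqrt_mul (by norm_num), sqrt_mul (by linarith), show (8:ℝ) / 9 = (2 * √2 / 3) ^ 2 by
      rw [div_pow, mul_pow, sq_sqrt (by norm_num)]; norm_num, sqrt_sq (by positivity)]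
    unfold qx; ring
  rw [hkey]
  have hQ := qx_pos hx0 hx1
  have h2 : (0:ℝ) < √2 := by positivity
  field_simp
  rw [sq_sqrt (by norm_num : (0:ℝ) ≤ 2)]; ring

/-- Auxiliary step of the contact lens-pair computation (see the module docstring). [folklore] -/
theorem hasDerivAt_phi : HasDerivAt phi (1 / ((1 + x) * √(1 + 2 * x))) x := by
  have hx : 0 < 1 + x := by linarith
  have hl : HasDerivAt (fun x : ℝ => x / (1 + x)) (1 / (1 + x) ^ 2) x := by
    have h := (hasDerivAt_id' x).div ((hasDerivAt_id' x).const_add 1) hx.ne'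
    refine h.congr_deriv ?_
    field_simp; ring
  have hne1 : x / (1 + x) ≠ -1 := by
    rw [Ne, div_eq_iff hx.ne']; intro h; linarith
  have hne2 : x / (1 + x) ≠ 1 := by
    rw [Ne, div_eq_iff hx.ne']; intro h; linarith
  have h := (hasDerivAt_arcsin hne1 hne2).comp x hl
  have h2 : HasDerivAt phi (1 / √(1 - (x / (1 + x)) ^ 2) * (1 / (1 + x) ^ 2)) x := h
  refine h2.congr_deriv ?_
  have hkey : √(1 - (x / (1 + x)) ^ 2) = √(1 + 2 * x) / (1 + x) := by
    have : 1 - (x / (1 + x)) ^ 2 = (1 + 2 * x) / (1 + x) ^ 2 := by field_simp; ring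
    rw [this, sqrt_div (by linarith), sqrt_sq hx.le]
  rw [hkey]
  have : 0 < √(1 + 2 * x) := sqrt_pos.mpr (by linarith)
  field_simp

/-- Auxiliary step of the contact lens-pair computation (see the module docstring). [folklore] -/
theorem hasDerivAt_th1 : HasDerivAt th1 (1 / ((1 + x) * (√2 * qx x))) x := by
  have hx : 0 < 1 + x := by linarith
  have hx' : 0 < 1 - x := by linarith
  set u : ℝ := (1 - x) / (3 * (1 + x)) with hu_def
  have hu0 : 0 < u := by positivity
  have hu1 : u < 1 := by
    rw [hu_def, div_lt_one (by positivity)]; linarith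
  have hu : HasDerivAt (fun x : ℝ => (1 - x) / (3 * (1 + x))) (-2 / (3 * (1 + x) ^ 2)) x := by
    have h := ((hasDerivAt_const x (1:ℝ)).sub (hasDerivAt_id' x)).div
      (((hasDerivAt_id' x).const_add 1).const_mul 3) (by positivity)
    refine h.congr_deriv ?_
    simp only [Pi.sub_apply]
    field_simp; ring
  have hv : HasDerivAt (fun x : ℝ => √((1 - x) / (3 * (1 + x))))
      ((-2 / (3 * (1 + x) ^ 2)) / (2 * √u)) x := hu.sqrt hu0.ne'
  have hsu0 : 0 < √u := sqrt_pos.mpr hu0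
  have hsu1 : √u < 1 := by rw [sqrt_lt' one_pos]; simpa using hu1
  have hne1 : √u ≠ -1 := by linarith [hsu0]
  have hne2 : √u ≠ 1 := hsu1.ne
  have h := (hasDerivAt_arccos hne1 hne2).comp x hv
  have h2 : HasDerivAt th1 (-(1 / √(1 - √u ^ 2)) * ((-2 / (3 * (1 + x) ^ 2)) / (2 * √u))) x := h
  refine h2.congr_deriv ?_
  have hkey1 : √(1 - √u ^ 2) = √(1 - u) := by rw [sq_sqrt hu0.le]
  have hprod : √u * √(1 - u) = √2 * qx x / (3 * (1 + x)) := by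
    rw [← sqrt_mul hu0.le]
    have : u * (1 - u) = 2 * ((1 - x) * (1 + 2 * x)) / (3 * (1 + x)) ^ 2 := by
      rw [hu_def]; field_simp; ring
    rw [this, sqrt_div (by nlinarith), sqrt_sq (by positivity),
      sqrt_mul (by norm_num), sqrt_mul (by linarith)]
    unfold qx; ring
  have h1u : 0 < √(1 - u) := sqrt_pos.mpr (by linarith)
  rw [hkey1]
  have hQ := qx_pos hx0 hx1
  have h2 : (0:ℝ) < √2 := by positivity
  rw [show √2 * qx x = 3 * (1 + x) * (√u * √(1 - u)) by rw [hprod]; field_simp]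
  field_simp

end atoms

/-! ### the explicit polynomials (from the `J_k` reduction, `tools/outer_poly.py`) -/

/-- `W(x) = ∫ p₁`, `p₁ = -(1-x²)(1621+135x²)/384`. [folklore] -/
def polW (x : ℝ) : ℝ := P6 0 (-1621 / 384) 0 (743 / 576) 0 (9 / 128) 0 x

/-- `∫ Wq/q = polPJ1·q + cJ1·asn₂/√2` where `Wq = (W - 103/36·?)…` (quotient of `W` by `1+x`). [folklore] -/
def polPJ1 (x : ℝ) : ℝ := P6 (507029 / 1179648) (-101017 / 294912) (27 / 4096) (-9 / 1024) 0 0 0 x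

/-- `∫ (x - x³/3)/q = polPJ2·q + (67/384)·asn₂/√2`. [folklore] -/
def polPJ2 (x : ℝ) : ℝ := P6 (-241 / 576) (5 / 144) (1 / 18) 0 0 0 0 x

/-- `∫ (99+64x-57x²-52x³)Q₂/q = polPJ3·q + (6993/128)·asn₂/√2`. [folklore] -/
def polPJ3 (x : ℝ) : ℝ := P6 (-16471 / 960) (12707 / 240) (739 / 30) (-68 / 5) (-52 / 5) 0 0 x

/-- `u(x)` with `∫ (1+x)(11x³-15x²-127x+155)√(1-x) = -(1-x)√(1-x)·u(x)`. [folklore] -/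
def polU (x : ℝ) : ℝ := P6 (28214 / 315) (-2168 / 105) (-836 / 21) (8 / 9) 2 0 0 x

/-- `∫ Gq/q = polPJ4·q + cJ4·asn₂/√2`, `Gq` = quotient of `(1-x)²u` by `1+x`. [folklore] -/
def polPJ4 (x : ℝ) : ℝ := P6 (-13656067 / 1935360) (-9429793 / 483840) (358027 / 60480) (379 / 720) (-1 / 5) 0 0 x

/-- antiderivative of `-(1-x²)(1621+135x²)/384 · θ₁`. [folklore] -/
def FL1 (x : ℝ) : ℝ :=
  polW x * th1 x - polPJ1 x * qx x / √2 - (-6449101 / 2359296) / 2 * asn2 x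
    - (103 / 36) / 2 * (2 * th1 x - π / 2)

/-- antiderivative of `(2/3)(1-x²)·asn₂`. [folklore] -/
def FL2 (x : ℝ) : ℝ := 2 / 3 * ((x - x ^ 3 / 3 - 67 / 384) * asn2 x - √2 * polPJ2 x * qx x)

/-- antiderivative of `(√2/384)(99+64x-57x²-52x³)·q`. [folklore] -/
def FL3 (x : ℝ) : ℝ := 1 / 384 * (√2 * polPJ3 x * qx x + 6993 / 128 * asn2 x)

/-- `U(x) = ∫ (1+x)(11x³-15x²-127x+155)√(1-x) dx` (vanishing at `1`). [folklore] -/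
def UL (x : ℝ) : ℝ := -(1 - x) * √(1 - x) * polU x

/-- antiderivative of `U·φ'`. [folklore] -/
def IUL (x : ℝ) : ℝ :=
  -(polPJ4 x * qx x + (-223836071 / 1290240) / √2 * asn2 x + (90112 / 315) / √2 * (2 * th1 x - π / 2))

/-- antiderivative of `-(√2/128)(1+x)(11x³-15x²-127x+155)√(1-x)(π/2 - φ)`. [folklore] -/
def FL4 (x : ℝ) : ℝ := -(√2 / 128) * (UL x * (π / 2 - phi x) + IUL x)

section derivsL
variable {x : ℝ} (hx0 : 1 / 2 < x) (hx1 : x < 1)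
include hx0 hx1

/-- Auxiliary step of the contact lens-pair computation (see the module docstring). [folklore] -/
theorem hasDerivAt_FL1 :
    HasDerivAt FL1 (-(1 - x ^ 2) * (1621 + 135 * x ^ 2) / 384 * th1 x) x := by
  have hQ := qx_pos hx0 hx1
  have h2 : (0:ℝ) < √2 := by positivity
  have e2 : √2 ^ 2 = (2:ℝ) := sq_sqrt (by norm_num)
  have eq : qx x ^ 2 = (1 - x) * (1 + 2 * x) := by
    unfold qx; rw [mul_pow, sq_sqrt (by linarith), sq_sqrt (by linarith)]
  have hx : (0:ℝ) < 1 + x := by linarith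
  have hW := hasDerivAt_P6 0 (-1621 / 384) 0 (743 / 576) 0 (9 / 128) 0 x
  have hP := hasDerivAt_P6 (507029 / 1179648) (-101017 / 294912) (27 / 4096) (-9 / 1024) 0 0 0 x
  have h := (((hW.mul (hasDerivAt_th1 hx0 hx1)).sub (((hP.mul (hasDerivAt_qx hx0 hx1)).div_const √2))).sub
    ((hasDerivAt_asn2 hx0 hx1).const_mul ((-6449101 / 2359296) / 2))).sub
    ((((hasDerivAt_th1 hx0 hx1).const_mul 2).sub_const (π / 2)).const_mul ((103 / 36) / 2))
  have h' := h.congr_of_eventuallyEq (f₁ := FL1) (Filter.Eventually.of_forall fun y => by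
    simp only [FL1, polW, polPJ1, Pi.mul_apply, Pi.sub_apply])
  refine h'.congr_deriv ?_
  unfold P6
  field_simp
  grind

/-- Auxiliary step of the contact lens-pair computation (see the module docstring). [folklore] -/
theorem hasDerivAt_FL2 : HasDerivAt FL2 (2 / 3 * (1 - x ^ 2) * asn2 x) x := by
  have hQ := qx_pos hx0 hx1
  have h2 : (0:ℝ) < √2 := by positivity
  have e2 : √2 ^ 2 = (2:ℝ) := sq_sqrt (by norm_num)
  have eq : qx x ^ 2 = (1 - x) * (1 + 2 * x) := by
    unfold qx; rw [mul_pow, sq_sqrt (by linarith), sq_sqrt (by linarith)]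
  have hP := hasDerivAt_P6 (-241 / 576) (5 / 144) (1 / 18) 0 0 0 0 x
  have hc : HasDerivAt (fun x : ℝ => x - x ^ 3 / 3 - 67 / 384) (1 - x ^ 2) x := by
    have h := ((hasDerivAt_id' x).sub (((hasDerivAt_id' x).pow 3).div_const 3)).sub_const (67 / 384)
    refine h.congr_deriv ?_; push_cast; ring
  have h := ((hc.mul (hasDerivAt_asn2 hx0 hx1)).sub
    (((hP.mul (hasDerivAt_qx hx0 hx1)).const_mul √2))).const_mul (2 / 3)
  have h' := h.congr_of_eventuallyEq (f₁ := FL2) (Filter.Eventually.of_forall fun y => by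
    simp only [FL2, polPJ2, Pi.mul_apply, Pi.sub_apply]; ring)
  refine h'.congr_deriv ?_
  unfold P6
  field_simp
  grind

/-- Auxiliary step of the contact lens-pair computation (see the module docstring). [folklore] -/
theorem hasDerivAt_FL3 :
    HasDerivAt FL3 (√2 / 384 * (99 + 64 * x - 57 * x ^ 2 - 52 * x ^ 3) * qx x) x := by
  have hQ := qx_pos hx0 hx1
  have h2 : (0:ℝ) < √2 := by positivity
  have e2 : √2 ^ 2 = (2:ℝ) := sq_sqrt (by norm_num)
  have eq : qx x ^ 2 = (1 - x) * (1 + 2 * x) := by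
    unfold qx; rw [mul_pow, sq_sqrt (by linarith), sq_sqrt (by linarith)]
  have hP := hasDerivAt_P6 (-16471 / 960) (12707 / 240) (739 / 30) (-68 / 5) (-52 / 5) 0 0 x
  have h := (((hP.mul (hasDerivAt_qx hx0 hx1)).const_mul √2).add
    ((hasDerivAt_asn2 hx0 hx1).const_mul (6993 / 128))).const_mul (1 / 384)
  have h' := h.congr_of_eventuallyEq (f₁ := FL3) (Filter.Eventually.of_forall fun y => by
    simp only [FL3, polPJ3, Pi.mul_apply, Pi.add_apply]; ring)
  refine h'.congr_deriv ?_
  unfold P6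
  field_simp
  grind

omit hx0 in
/-- Auxiliary step of the contact lens-pair computation (see the module docstring). [folklore] -/
theorem hasDerivAt_UL :
    HasDerivAt UL ((1 + x) * (11 * x ^ 3 - 15 * x ^ 2 - 127 * x + 155) * √(1 - x)) x := by
  have hs : 0 < √(1 - x) := sqrt_pos.mpr (by linarith)
  have es : √(1 - x) ^ 2 = 1 - x := sq_sqrt (by linarith)
  have hP := hasDerivAt_P6 (28214 / 315) (-2168 / 105) (-836 / 21) (8 / 9) 2 0 0 x
  have hl : HasDerivAt (fun x : ℝ => -(1 - x)) (-(-1 : ℝ)) x := ((hasDerivAt_id' x).const_sub 1).neg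
  have h := (hl.mul (hasDerivAt_sqrt_one_sub hx1)).mul hP
  have h' := h.congr_of_eventuallyEq (f₁ := UL) (Filter.Eventually.of_forall fun y => by
    simp only [UL, polU, Pi.mul_apply])
  refine h'.congr_deriv ?_
  simp only [Pi.mul_apply, P6]
  field_simp
  grind

/-- Auxiliary step of the contact lens-pair computation (see the module docstring). [folklore] -/
theorem hasDerivAt_IUL : HasDerivAt IUL (UL x * (1 / ((1 + x) * √(1 + 2 * x)))) x := by
  have hQ := qx_pos hx0 hx1
  have hs : 0 < √(1 - x) := sqrt_pos.mpr (by linarith)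
  have ht : 0 < √(1 + 2 * x) := sqrt_pos.mpr (by linarith)
  have h2 : (0:ℝ) < √2 := by positivity
  have e2 : √2 ^ 2 = (2:ℝ) := sq_sqrt (by norm_num)
  have es : √(1 - x) ^ 2 = 1 - x := sq_sqrt (by linarith)
  have et : √(1 + 2 * x) ^ 2 = 1 + 2 * x := sq_sqrt (by linarith)
  have hx : (0:ℝ) < 1 + x := by linarith
  have hP := hasDerivAt_P6 (-13656067 / 1935360) (-9429793 / 483840) (358027 / 60480) (379 / 720) (-1 / 5) 0 0 x
  have h := (((hP.mul (hasDerivAt_qx hx0 hx1)).add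
    ((hasDerivAt_asn2 hx0 hx1).const_mul ((-223836071 / 1290240) / √2))).add
    ((((hasDerivAt_th1 hx0 hx1).const_mul 2).sub_const (π / 2)).const_mul ((90112 / 315) / √2))).neg
  have h' := h.congr_of_eventuallyEq (f₁ := IUL) (Filter.Eventually.of_forall fun y => by
    simp only [IUL, polPJ4, Pi.mul_apply, Pi.add_apply, Pi.neg_apply])
  refine h'.congr_deriv ?_
  unfold UL polU P6 qx
  field_simp
  grind

/-- Auxiliary step of the contact lens-pair computation (see the module docstring). [folklore] -/
theorem hasDerivAt_FL4 : HasDerivAt FL4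
    (-(√2 / 128) * (1 + x) * (11 * x ^ 3 - 15 * x ^ 2 - 127 * x + 155) * √(1 - x) * (π / 2 - phi x)) x := by
  have h := (((hasDerivAt_UL hx1).mul ((hasDerivAt_phi hx0 hx1).const_sub (π / 2))).add
    (hasDerivAt_IUL hx0 hx1)).const_mul (-(√2 / 128))
  have h' := h.congr_of_eventuallyEq (f₁ := FL4) (Filter.Eventually.of_forall fun y => by
    simp only [FL4, Pi.mul_apply, Pi.add_apply])
  refine h'.congr_deriv ?_
  ring

end derivsL

/-! ### The outer integral -/

/-- total outer integrand `h = hO + hS` (θ₂ has cancelled). [folklore] -/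
def htot (x : ℝ) : ℝ :=
  7 * π / 3 * (1 - x ^ 2) - (1 - x ^ 2) * (1621 + 135 * x ^ 2) / 384 * th1 x
    + 2 / 3 * (1 - x ^ 2) * asn2 x
    + √2 / 384 * (99 + 64 * x - 57 * x ^ 2 - 52 * x ^ 3) * qx x
    - √2 / 128 * (1 + x) * (11 * x ^ 3 - 15 * x ^ 2 - 127 * x + 155) * √(1 - x) * (π / 2 - phi x)

/-- antiderivative of `htot`. [folklore] -/
def Ftot (x : ℝ) : ℝ := 7 * π / 3 * (x - x ^ 3 / 3) + FL1 x + FL2 x + FL3 x + FL4 x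

/-- Auxiliary step of the contact lens-pair computation (see the module docstring). [folklore] -/
theorem hasDerivAt_Ftot {x : ℝ} (hx0 : 1 / 2 < x) (hx1 : x < 1) : HasDerivAt Ftot (htot x) x := by
  have hp : HasDerivAt (fun x : ℝ => 7 * π / 3 * (x - x ^ 3 / 3)) (7 * π / 3 * (1 - x ^ 2)) x := by
    have h := ((hasDerivAt_id' x).sub (((hasDerivAt_id' x).pow 3).div_const 3)).const_mul (7 * π / 3)
    refine h.congr_deriv ?_; push_cast; ring
  have h := (((hp.add (hasDerivAt_FL1 hx0 hx1)).add (hasDerivAt_FL2 hx0 hx1)).add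
    (hasDerivAt_FL3 hx0 hx1)).add (hasDerivAt_FL4 hx0 hx1)
  have h' : HasDerivAt Ftot _ x := h
  refine h'.congr_deriv ?_
  unfold htot; ring

/-! continuity on `[1/2, 1]` -/

/-- Auxiliary step of the contact lens-pair computation (see the module docstring). [folklore] -/
theorem continuousOn_th1 : ContinuousOn th1 (Icc (1 / 2) 1) := by
  unfold th1
  refine continuous_arccos.comp_continuousOn (continuous_sqrt.comp_continuousOn ?_)
  exact ContinuousOn.div (by fun_prop) (by fun_prop) (fun x hx => by have := hx.1; positivity)

/-- Auxiliary step of the contact lens-pair computation (see the module docstring). [folklore] -/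
theorem continuous_asn2 : Continuous asn2 := by unfold asn2; exact continuous_arcsin.comp (by fun_prop)

/-- Auxiliary step of the contact lens-pair computation (see the module docstring). [folklore] -/
theorem continuousOn_phi : ContinuousOn phi (Icc (1 / 2) 1) := by
  unfold phi
  refine continuous_arcsin.comp_continuousOn ?_
  exact ContinuousOn.div (by fun_prop) (by fun_prop) (fun x hx => by have := hx.1; positivity)

/-- Auxiliary step of the contact lens-pair computation (see the module docstring). [folklore] -/
theorem continuous_qx : Continuous qx := by unfold qx; fun_prop

/-- Auxiliary step of the contact lens-pair computation (see the module docstring). [folklore] -/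
theorem continuousOn_Ftot : ContinuousOn Ftot (Icc (1 / 2) 1) := by
  have h1 := continuousOn_th1
  have h2 := continuous_asn2.continuousOn (s := Icc (1 / 2 : ℝ) 1)
  have h3 := continuousOn_phi
  have h4 := continuous_qx.continuousOn (s := Icc (1 / 2 : ℝ) 1)
  unfold Ftot FL1 FL2 FL3 FL4 UL IUL polW polPJ1 polPJ2 polPJ3 polPJ4 polU P6
  apply ContinuousOn.add
  · apply ContinuousOn.add
    · apply ContinuousOn.add
      · apply ContinuousOn.add
        · fun_prop
        · apply ContinuousOn.sub
          · apply ContinuousOn.sub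
            · exact ContinuousOn.sub (ContinuousOn.mul (by fun_prop) h1)
                (ContinuousOn.div_const (ContinuousOn.mul (by fun_prop) h4) _)
            · exact ContinuousOn.mul continuousOn_const h2
          · exact ContinuousOn.mul continuousOn_const ((h1.const_smul (2:ℝ)).sub continuousOn_const)
      · exact ContinuousOn.mul continuousOn_const (ContinuousOn.sub (ContinuousOn.mul (by fun_prop) h2)
          (ContinuousOn.mul (by fun_prop) h4))
    · exact ContinuousOn.mul continuousOn_const
        ((ContinuousOn.mul (by fun_prop) h4).add (ContinuousOn.mul continuousOn_const h2))
  · apply ContinuousOn.mul continuousOn_const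
    apply ContinuousOn.add
    · exact ContinuousOn.mul (by fun_prop) (continuousOn_const.sub h3)
    · exact ((ContinuousOn.mul (by fun_prop) h4).add (ContinuousOn.mul continuousOn_const h2) |>.add
        (ContinuousOn.mul continuousOn_const ((h1.const_smul (2:ℝ)).sub continuousOn_const))).neg

/-- Auxiliary step of the contact lens-pair computation (see the module docstring). [folklore] -/
theorem continuousOn_htot : ContinuousOn htot (Icc (1 / 2) 1) := by
  have h1 := continuousOn_th1
  have h2 := continuous_asn2.continuousOn (s := Icc (1 / 2 : ℝ) 1)
  have h3 := continuousOn_phi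
  have h4 := continuous_qx.continuousOn (s := Icc (1 / 2 : ℝ) 1)
  unfold htot
  apply ContinuousOn.sub
  · apply ContinuousOn.add
    · apply ContinuousOn.add
      · exact ContinuousOn.sub (by fun_prop) (ContinuousOn.mul (by fun_prop) h1)
      · exact ContinuousOn.mul (by fun_prop) h2
    · exact ContinuousOn.mul (by fun_prop) h4
  · exact ContinuousOn.mul (by fun_prop) (continuousOn_const.sub h3)

/-! values at the endpoints -/

/-- Auxiliary step of the contact lens-pair computation (see the module docstring). [folklore] -/
theorem th1_one : th1 1 = π / 2 := by simp [th1]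

/-- Auxiliary step of the contact lens-pair computation (see the module docstring). [folklore] -/
theorem th1_half : th1 (1 / 2) = arccos (1 / 3) := by
  unfold th1; congr 1
  rw [show ((1 : ℝ) - 1 / 2) / (3 * (1 + 1 / 2)) = (1 / 3) ^ 2 by norm_num, sqrt_sq (by norm_num)]

/-- Auxiliary step of the contact lens-pair computation (see the module docstring). [folklore] -/
theorem asn2_one : asn2 1 = π / 2 := by simp [asn2]; norm_num

/-- Auxiliary step of the contact lens-pair computation (see the module docstring). [folklore] -/
theorem asn2_half : asn2 (1 / 2) = π / 2 - arccos (1 / 3) := by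
  unfold asn2; rw [arcsin_eq_pi_div_two_sub_arccos]; norm_num

/-- Auxiliary step of the contact lens-pair computation (see the module docstring). [folklore] -/
theorem phi_half : phi (1 / 2) = π / 2 - arccos (1 / 3) := by
  unfold phi; rw [arcsin_eq_pi_div_two_sub_arccos]; norm_num

/-- Auxiliary step of the contact lens-pair computation (see the module docstring). [folklore] -/
theorem qx_one : qx 1 = 0 := by simp [qx]

/-- Auxiliary step of the contact lens-pair computation (see the module docstring). [folklore] -/
theorem qx_half : qx (1 / 2) = 1 := by
  unfold qx
  rw [← sqrt_mul (by norm_num)]; norm_num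

/-- Auxiliary step of the contact lens-pair computation (see the module docstring). [folklore] -/
theorem sqrt_one_sub_half : √(1 - 1 / 2 : ℝ) = √2 / 2 := by
  rw [show (1 : ℝ) - 1 / 2 = 2 / 2 ^ 2 by norm_num, sqrt_div (by norm_num), sqrt_sq (by norm_num)]

/-- **The outer integral.** [folklore] -/
theorem integral_htot : ∫ x in (1 / 2 : ℝ)..1, htot x =
    -(89 / 1260) * π + 459 / 1120 * arccos (1 / 3) - 73 / 1680 * √2 := by
  rw [integral_eq_sub_of_hasDerivAt_of_le (by norm_num) continuousOn_Ftot
    (fun x hx => hasDerivAt_Ftot hx.1 hx.2) (continuousOn_htot.intervalIntegrable_of_Icc (by norm_num))]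
  have e2 : √2 ^ 2 = (2:ℝ) := sq_sqrt (by norm_num)
  have h2 : (0:ℝ) < √2 := by positivity
  unfold Ftot FL1 FL2 FL3 FL4 UL IUL polW polPJ1 polPJ2 polPJ3 polPJ4 polU P6
  rw [th1_one, th1_half, asn2_one, asn2_half, phi_half, qx_one, qx_half, sqrt_one_sub_half,
    show √(1 - (1:ℝ)) = 0 by simp]
  field_simp
  grind


end BoltzmannB4Contact

end Literature.MathematicalPhysics.StatisticalMechanics

end
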